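import Literature.Barriers.RiemannHypothesis.TuranPartialSumsMontgomeryLine
import Literature.Barriers.RiemannHypothesis.TuranPartialSumsMontgomeryPerron
import Literature.Barriers.RiemannHypothesis.TuranPartialSumsMontgomeryRouche
import Literature.Barriers.RiemannHypothesis.TuranPartialSumsBohr
import Mathlib.Analysis.SpecialFunctions.Pow.Asymptotics
import HarnessLib

/-!
# Montgomery 1983 — proof of `Montgomery1983_theorem`

Proofs-only companion of `Literature/Barriers/RiemannHypothesis/TuranPartialSums.lean`: it discharges the named
fact `Literature.Barriers.RiemannHypothesis.Montgomery1983_theorem` (H. L. Montgomery, *Zeros of approximations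
to the zeta function*, 1983, Theorem p. 497: for `0 < c < 4/π − 1` and `N > N₀(c)`, `Σ_{n ≤ N} n^{-s}` has zeros
in `σ > 1 + c (log log N)/log N`) as `Montgomery1983_theorem_holds`. No definitions, no named facts.

The argument follows the source. §2: by Bohr's equivalence theorem it suffices to find, for a completely
multiplicative unimodular twist `a`, a zero of `Σ_{n ≤ N} a(n) n^{-s}` in the same half-plane
(`Montgomery1983_theorem_of_twisted_zeros`, file `TuranPartialSumsBohr.lean`). The twist `a = a_m` of
`TuranPartialSumsMontgomeryTwist.lean` ((8)–(13)) has `κ = b̂(1) − b̂(0) − 1 > c` for `m` large. §3: its Dirichlet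
series is `f = exp Φ` with the singularities described by Lemma 4 (`TuranPartialSumsMontgomeryEuler.lean`). §4:
`norm_partialSum_sub_main_le` assembles the truncated Perron formula (`TuranPartialSumsMontgomeryPerron.lean`),
the piece-by-piece analysis of the line integral (`TuranPartialSumsMontgomeryLine.lean`) and the Hankel integral
(`TuranPartialSumsMontgomeryHankel.lean`) into
`F_N(s) = f(s) + D Λ^{β−1} x^{1+i−s}/(Γ(β)(1 + 1/Λ + i − s)) + (error)` just right of `1`
(`x = N + 1/2`, `Λ = log x`, `β = b̂(1)`); `exists_twistedPartialSum_zero` compares `F_N` with the model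
`a e^{−Λ(s−1)} + C`, `C = f(1 + κ log Λ/Λ)`, on a disc of radius `1/(2Λ)` about a zero `s₀` of the model and
applies Rouché's theorem (`TuranPartialSumsMontgomeryRouche.lean`), giving a zero with
`Re s > 1 + (κ log Λ − β₀ log(κ log Λ) − O(1))/Λ` (`β₀ = −b̂(0)`); the hypotheses of that quantitative core hold
for all large `Λ` (`eventually_basic`, `eventually_R`, `eventually_k0`, `eventually_rest`,
`eventually_exponent`), which yields the theorem since `κ > c`.

Deviation from the printed proof: the contour is kept on `Re(s+w) = 1 + 1/log x` (no continuation of `log ζ`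
to the left of `1` is used), at the price of the explicit piece-by-piece bookkeeping of
`TuranPartialSumsMontgomeryLine.lean`; the exponent obtained is the same.

## References

* [Montgomery1983] H. L. Montgomery, *Zeros of approximations to the zeta function*, in: Studies in Pure
  Mathematics to the memory of Paul Turán, Birkhäuser 1983, 497–506.
-/

noncomputable section

open Complex Set Filter Topology MeasureTheory intervalIntegral
open scoped Interval

namespace Literature.Barriers.RiemannHypothesis

section Line

variable (m : ℕ)


section Assembly

variable {A₁ A₂ A₃ A₄ : ℝ}
  (h18 : ∀ (k : ℤ) (z : ℂ), 1 < z.re → z.re ≤ 2 → |z.im - k| ≤ 1 / 2 →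
    ‖montgomeryPhi m z + (montgomeryCoeff m k : ℂ) * log (z - 1 - k * I)‖ ≤
      A₁ + A₂ * Real.log (Real.log (|(k : ℝ)| + 5)))
  (h19 : ∀ (k : ℤ) (z : ℂ), 1 < z.re → z.re ≤ 2 → |z.im - k| ≤ 1 / 2 →
    ‖montgomeryPhiDeriv m z + (montgomeryCoeff m k : ℂ) / (z - 1 - k * I)‖ ≤ A₃ + A₄ * Real.log (|(k : ℝ)| + 5))
include h18 h19

omit h18 h19 in
/-- Splitting off the two central terms of a sum over `range (2K₀+1)`. [folklore] -/
theorem sum_range_split_two {K₀ : ℕ} (hK : 1 ≤ K₀) (g : ℕ → ℂ) :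
    ∑ i ∈ Finset.range (2 * K₀ + 1), g i = g K₀ + g (K₀ + 1) +
      ∑ i ∈ (Finset.range (2 * K₀ + 1)).filter (fun i ↦ i ≠ K₀ ∧ i ≠ K₀ + 1), g i := by
  have h0 : K₀ ∈ Finset.range (2 * K₀ + 1) := by simp; omega
  have h1 : K₀ + 1 ∈ (Finset.range (2 * K₀ + 1)).erase K₀ := by simp; omega
  rw [← Finset.add_sum_erase _ _ h0, ← Finset.add_sum_erase _ _ h1, add_assoc]
  congr 2
  refine Finset.sum_congr ?_ fun _ _ ↦ rfl
  ext i; simp only [Finset.mem_erase, Finset.mem_filter, Finset.mem_range]; tauto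

/-- **The approximate formula for `F_N(s)` just right of `1`** (all of §4 assembled): with `x = N + 1/2`,
`Λ = log x`, `α = 1 + 1/Λ − σ < 0`, `t = Im s`, `K₀ = ⌈Λ³⌉`, `β = b̂(1)`, `D = g₁(0)`,
`F_N(s) = f(s) + x^{α} x^{i(1−t)} (D/(α + i(1−t))) Λ^{β−1} e^{-1}/Γ(β) + O(x^α · ERR)`
where `ERR` collects the Hankel tail, the window error, the piece-minus-window error, the other pieces,
the piece `k = 0`, and the Perron truncation. [cite: Montgomery1983, §4 (20)–(24)] -/
theorem norm_partialSum_sub_main_le (hA₂ : 0 ≤ A₂) (hA₃ : 0 ≤ A₃) (hA₄ : 0 ≤ A₄) {N : ℕ} (hN : 1 ≤ N)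
    (hΛ : 4 ≤ Real.log ((N : ℝ) + 1 / 2))
    (hLw : (A₃ + A₄ * Real.log 6) * (Real.log ((N : ℝ) + 1 / 2)) ^ (-(1 / 2 : ℝ)) ≤ 1)
    {s : ℂ} (hσ : 1 + 1 / Real.log ((N : ℝ) + 1 / 2) < s.re) (ht : |s.im| ≤ 1 / 4)
    (hta : |s.im| ≤ |1 + 1 / Real.log ((N : ℝ) + 1 / 2) - s.re| / 2)
    (ha1 : 1 / Real.log ((N : ℝ) + 1 / 2) ≤ |1 + 1 / Real.log ((N : ℝ) + 1 / 2) - s.re| / 2)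
    (ha2 : |1 + 1 / Real.log ((N : ℝ) + 1 / 2) - s.re| / 2 ≤ 1 / 2) :
    let x : ℝ := (N : ℝ) + 1 / 2
    let Λ : ℝ := Real.log x
    let α : ℝ := 1 + 1 / Λ - s.re
    let t : ℝ := s.im
    let β : ℝ := montgomeryCoeff m 1
    let β₀ : ℝ := -montgomeryCoeff m 0
    let a : ℝ := |α| / 2
    let K₀ : ℕ := ⌈Λ ^ 3⌉₊
    let M₁ : ℝ := Real.exp (A₁ + A₂ * Real.log (Real.log 6))
    let L₁ : ℝ := A₃ + A₄ * Real.log 6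
    let M₀ : ℝ := Real.exp (A₁ + A₂ * Real.log (Real.log 5))
    let L₀ : ℝ := A₃ + A₄ * Real.log 5
    let Ms : ℝ := Real.exp (A₁ + A₂ * Real.log (Real.log ((K₀ : ℝ) + 5)))
    let Ls : ℝ := A₃ + A₄ * Real.log ((K₀ : ℝ) + 5)
    ‖twistedPartialSum (fun n ↦ (montgomeryTwist m n : ℂ)) N s - montgomeryF m s -
        (x : ℂ) ^ (α : ℂ) * ((x : ℂ) ^ (((1 - t : ℝ) : ℂ) * I) * (gOne m Λ 0 / ((α : ℂ) + ((1 - t : ℝ) : ℂ) * I)) *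
          ((Λ ^ (β - 1) * Real.exp (-1) / Real.Gamma β : ℝ) : ℂ))‖ ≤
      x ^ α * ((1 / (2 * Real.pi)) *
        (4 * M₀ * (2 / Λ) ^ β₀ / (Λ * a) +
            8 * M₀ / Λ * (Λ ^ (montgomeryCoeff m 0) / a + 2 + a ^ (β₀ - 1) * (3 + 3 / (1 - β₀)) + L₀ / β₀) +
          Ms / Λ * (40 * Λ ^ (1 / 3 : ℝ) + 48 * Ls + 224) * (2 * (1 + Real.log K₀)) +
          4 * M₁ * Λ ^ (β - 1) * (2 * Λ ^ (-(β / 2))) +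
          (16 * L₁ + 32) * M₁ * (Λ ^ (-(1 / 2 : ℝ))) ^ (2 - β) +
          16 * M₁ / (Λ * 1) * (2 * (Λ ^ (-(1 / 2 : ℝ))) ^ (-(max β 0)) + 3 * L₁ + 14) +
          (1 / ((K₀ : ℝ) + 1 / 2 - t) + 1 / ((K₀ : ℝ) + 1 / 2 + t)) *
            (6 * (1 + Real.log ((N + 1 : ℕ) : ℝ)) + 2 * ((1 + 1 / Λ) / ((1 + 1 / Λ) - 1))))) := by
  intro x Λ α t β β₀ a K₀ M₁ L₁ M₀ L₀ Ms Ls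
  have hx1 : (1 : ℝ) < x := by simp only [x]; have := (Nat.one_le_cast (α := ℝ)).2 hN; linarith
  have hx0 : 0 < x := by linarith
  have hΛ2 : 2 ≤ Λ := by simp only [Λ, x]; linarith
  have hΛ0 : 0 < Λ := by linarith
  have hαneg : α < 0 := by simp only [α]; linarith
  have hαne : α ≠ 0 := hαneg.ne
  have hβpos : 0 < β := by have := (montgomeryCoeff_one_bounds m).1; simp only [β]; linarith
  have hβ1 : β < 1 := (abs_lt.1 (abs_montgomeryCoeff_lt_one m 1)).2
  have hst : s = (s.re : ℂ) + t * I := (re_add_im s).symm.trans (by simp [t, mul_comm])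
  -- unimodular constants
  have hcnorm : ∀ r : ℝ, ‖(x : ℂ) ^ ((r : ℂ) * I)‖ = 1 := fun r ↦ by
    rw [ofReal_cpow_eq_exp hx0, norm_exp]; simp
  set c : ℤ → ℂ := fun k ↦ (x : ℂ) ^ ((((k : ℝ) - t : ℝ) : ℂ) * I) with hc
  have hc1 : ∀ k, ‖c k‖ ≤ 1 := fun k ↦ (hcnorm _).le
  -- Perron
  have hT₁ : 0 < (K₀ : ℝ) + 1 / 2 - t := by
    have h1 : |t| ≤ 1 / 4 := ht
    have := (abs_le.1 h1).2
    have : (0 : ℝ) ≤ K₀ := Nat.cast_nonneg _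
    linarith
  have hT₂ : 0 < (K₀ : ℝ) + 1 / 2 + t := by
    have h1 : |t| ≤ 1 / 4 := ht
    have := (abs_le.1 h1).1
    have : (0 : ℝ) ≤ K₀ := Nat.cast_nonneg _
    linarith
  have hρ : 1 < s.re + α := by simp only [α]; linarith [one_div_pos.2 hΛ0]
  have hPerron := norm_perron_left_add_le (a := fun n ↦ (montgomeryTwist m n : ℂ))
    (fun n ↦ norm_montgomeryTwist_le_one m n) (s := s) hαneg hρ N hT₁ hT₂
  obtain ⟨_, hTS⟩ := tsum_perronWeight_le hN hρ
  have hρeq : s.re + α = 1 + 1 / Λ := by simp only [α]; ring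
  rw [hρeq] at hTS hPerron
  -- the pieces
  have hS1 := perron_integral_eq_sum_pieces m hx1 hΛ2 (s := s) (α := α) hρeq hαne K₀
  set P : ℕ → ℂ := fun i ↦ ∫ v in (-(1 / 2))..(1 / 2), pieceFun m Λ α t (c ((i : ℤ) - K₀)) ((i : ℤ) - K₀) v *
    exp (((Λ * v : ℝ) : ℂ) * I) with hP
  have hS1' : ∫ u in (-((K₀ : ℝ) + 1 / 2 + s.im))..((K₀ : ℝ) + 1 / 2 - s.im),
      montgomeryF m (s + α + u * I) * ((x : ℂ) ^ ((α : ℂ) + u * I) / ((α : ℂ) + u * I)) =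
      (x : ℂ) ^ (α : ℂ) * ∑ i ∈ Finset.range (2 * K₀ + 1), P i := by
    rw [hS1]
  have hK₀ : (Λ ^ 3 : ℝ) ≤ K₀ := Nat.le_ceil _
  have hK₀1 : 1 ≤ K₀ := by
    have h8 : (2 : ℝ) ^ 3 ≤ Λ ^ 3 := pow_le_pow_left₀ (by norm_num) hΛ2 3
    have : (1 : ℝ) ≤ Λ ^ 3 := by norm_num at h8; linarith
    exact_mod_cast this.trans hK₀
  have hsplit := sum_range_split_two hK₀1 P
  -- `k = 0`
  have hk0 : ((K₀ : ℕ) : ℤ) - K₀ = 0 := by simp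
  have hk1 : (((K₀ + 1 : ℕ)) : ℤ) - K₀ = 1 := by push_cast; ring
  have hP0 : ‖P K₀‖ ≤ 4 * M₀ * (2 / Λ) ^ β₀ / (Λ * a) +
      8 * M₀ / Λ * (Λ ^ (montgomeryCoeff m 0) / a + 2 + a ^ (β₀ - 1) * (3 + 3 / (1 - β₀)) + L₀ / β₀) := by
    have h := norm_pieceZero_le m h18 h19 hA₃ hA₄ hΛ2 (α := α) (t := t) hαne hta (c := c 0) (hc1 0) ha1 ha2
    simp only [hP, hk0]
    convert h using 2
  -- the other pieces
  have hPS : ‖∑ i ∈ (Finset.range (2 * K₀ + 1)).filter (fun i ↦ i ≠ K₀ ∧ i ≠ K₀ + 1), P i‖ ≤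
      Ms / Λ * (40 * Λ ^ (1 / 3 : ℝ) + 48 * Ls + 224) * (2 * (1 + Real.log K₀)) :=
    (norm_sum_le _ _).trans (sum_norm_pieces_le m h18 h19 hA₂ hA₃ hA₄ hΛ2 ht c hc1 K₀)
  -- `k = 1`
  set Aw : ℝ := Λ ^ (1 / 2 : ℝ) with hAw
  have hAw0 : 0 < Aw := Real.rpow_pos_of_pos hΛ0 _
  set w₀ : ℝ := Aw / Λ with hw₀
  have hw₀eq : w₀ = Λ ^ (-(1 / 2 : ℝ)) := by
    rw [hw₀, hAw, div_eq_mul_inv, ← Real.rpow_neg_one Λ, ← Real.rpow_add hΛ0]; norm_num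
  have hw₀1 : 1 / Λ ≤ w₀ := by
    rw [hw₀eq, one_div, ← Real.rpow_neg_one]
    exact Real.rpow_le_rpow_of_exponent_le (by linarith) (by norm_num)
  have hw₀2 : w₀ ≤ 1 / 2 := by
    rw [hw₀eq]
    have h4 : Λ ^ (-(1 / 2 : ℝ)) ≤ (4 : ℝ) ^ (-(1 / 2 : ℝ)) :=
      Real.rpow_le_rpow_of_nonpos (by norm_num) hΛ (by norm_num)
    refine h4.trans (le_of_eq ?_)
    rw [show (4 : ℝ) = 2 ^ (2 : ℝ) by norm_num, ← Real.rpow_mul (by norm_num)]; norm_num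
  have hLw' : (A₃ + A₄ * Real.log 6) * w₀ ≤ 1 := by rw [hw₀eq]; exact hLw
  set MC : ℂ := gOne m Λ 0 * c 1 / ((α : ℂ) + ((1 - t : ℝ) : ℂ) * I) with hMC
  set KER : ℂ := ∫ v in (-w₀)..w₀, (((1 / Λ : ℝ) : ℂ) + v * I) ^ (-(β : ℂ)) * exp (((Λ * v : ℝ) : ℂ) * I)
    with hKER
  set W₁ : ℂ := ∫ v in (-w₀)..w₀, pieceFun m Λ α t (c 1) 1 v * exp (((Λ * v : ℝ) : ℂ) * I) with hW₁
  have hP1W : ‖P (K₀ + 1) - W₁‖ ≤ 16 * M₁ / (Λ * 1) * (2 * w₀ ^ (-(max β 0)) + 3 * L₁ + 14) := by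
    have h := norm_piece_sub_window_le m h18 h19 hA₃ hA₄ hΛ2 (α := α) ht (hc1 1) (k := 1) one_ne_zero hw₀1 hw₀2
    rw [show (|((1 : ℤ) : ℝ)| + 5 : ℝ) = 6 by norm_num] at h
    simp only [Int.cast_one, abs_one] at h
    simp only [hP, hk1, hW₁]
    exact h
  have hWM : ‖W₁ - MC * KER‖ ≤ (16 * L₁ + 32) * M₁ * w₀ ^ (2 - β) :=
    norm_windowOne_sub_main_le m h18 h19 hA₃ hA₄ hΛ2 (α := α) ht (hc1 1) hw₀1 hw₀2 hLw'
  have hKER : KER = ((Λ ^ (β - 1) * Real.exp (-1) : ℝ) : ℂ) *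
      ∫ y in (-Aw)..Aw, ((1 : ℂ) + y * I) ^ (-(β : ℂ)) * exp ((1 : ℂ) + y * I) := by
    rw [hKER, hw₀]; exact integral_window_kernel_eq hΛ0 hAw0 β
  have hJ := norm_hankelLineIntegral_sub_le hβpos hβ1 hAw0
  have hAβ : Aw ^ (-β) = Λ ^ (-(β / 2)) := by
    rw [hAw, ← Real.rpow_mul hΛ0.le]; congr 1; ring
  rw [hAβ] at hJ
  have hMCn : ‖MC‖ ≤ M₁ * 4 := by
    rw [hMC, norm_div, norm_mul]
    have hD := (norm_gOne_le m h18 hΛ2 (v := 0) (by norm_num)).1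
    have hd : 1 / 4 ≤ ‖(α : ℂ) + ((1 - t : ℝ) : ℂ) * I‖ := by
      have := norm_pieceDen_ge (α := α) (t := t) (v := 0) (k := 1) one_ne_zero ht (by norm_num)
      simpa using this
    rw [div_le_iff₀ (by linarith)]
    calc ‖gOne m Λ 0‖ * ‖c 1‖ ≤ M₁ * 1 := mul_le_mul hD (hc1 1) (norm_nonneg _) (by positivity)
      _ = M₁ * 4 * (1 / 4) := by ring
      _ ≤ M₁ * 4 * ‖(α : ℂ) + ((1 - t : ℝ) : ℂ) * I‖ := mul_le_mul_of_nonneg_left hd (by positivity)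
  have hKmain : ‖MC * KER - MC * ((Λ ^ (β - 1) * Real.exp (-1) : ℝ) : ℂ) * ((2 * Real.pi / Real.Gamma β : ℝ) : ℂ)‖ ≤
      M₁ * 4 * (Λ ^ (β - 1) * (2 * Λ ^ (-(β / 2)))) := by
    rw [hKER, mul_assoc, ← mul_sub, ← mul_sub, norm_mul, norm_mul]
    refine mul_le_mul hMCn ?_ (by positivity) (by positivity)
    rw [Complex.norm_real, Real.norm_of_nonneg (by positivity)]
    calc Λ ^ (β - 1) * Real.exp (-1) * ‖(∫ y in (-Aw)..Aw, ((1 : ℂ) + y * I) ^ (-(β : ℂ)) * exp ((1 : ℂ) + y * I)) -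
          ((2 * Real.pi / Real.Gamma β : ℝ) : ℂ)‖
        ≤ Λ ^ (β - 1) * Real.exp (-1) * (2 * Real.exp 1 * Λ ^ (-(β / 2))) :=
          mul_le_mul_of_nonneg_left hJ (by positivity)
      _ = Λ ^ (β - 1) * (2 * Λ ^ (-(β / 2))) * (Real.exp (-1) * Real.exp 1) := by ring
      _ = _ := by rw [← Real.exp_add]; norm_num
  -- the main term identity
  have hmain : (x : ℂ) ^ (α : ℂ) * (MC * ((Λ ^ (β - 1) * Real.exp (-1) : ℝ) : ℂ) *
      ((2 * Real.pi / Real.Gamma β : ℝ) : ℂ)) = 2 * Real.pi *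
      ((x : ℂ) ^ (α : ℂ) * ((x : ℂ) ^ (((1 - t : ℝ) : ℂ) * I) * (gOne m Λ 0 / ((α : ℂ) + ((1 - t : ℝ) : ℂ) * I)) *
          ((Λ ^ (β - 1) * Real.exp (-1) / Real.Gamma β : ℝ) : ℂ))) := by
    have hΓ : (Real.Gamma β : ℂ) ≠ 0 := ofReal_ne_zero.2 (Real.Gamma_pos_of_pos hβpos).ne'
    simp only [hMC, hc]
    push_cast
    ring
  -- assemble
  have hPE : 0 ≤ x ^ α := (Real.rpow_pos_of_pos hx0 α).le
  have hxn : ‖(x : ℂ) ^ (α : ℂ)‖ = x ^ α := by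
    rw [← ofReal_cpow hx0.le, Complex.norm_real, Real.norm_of_nonneg hPE]
  set FN := twistedPartialSum (fun n ↦ (montgomeryTwist m n : ℂ)) N s with hFN
  set Q : ℂ := (∫ u in (-((K₀ : ℝ) + 1 / 2 + t))..((K₀ : ℝ) + 1 / 2 - t),
      montgomeryF m (s + α + u * I) * ((x : ℂ) ^ ((α : ℂ) + u * I) / ((α : ℂ) + u * I))) +
    2 * Real.pi * (montgomeryF m s - FN) with hQ
  have hQn : ‖Q‖ ≤ x ^ α * (1 / ((K₀ : ℝ) + 1 / 2 - t) + 1 / ((K₀ : ℝ) + 1 / 2 + t)) *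
      (6 * (1 + Real.log ((N + 1 : ℕ) : ℝ)) + 2 * ((1 + 1 / Λ) / ((1 + 1 / Λ) - 1))) := by
    refine hPerron.trans ?_
    exact mul_le_mul_of_nonneg_left hTS (by positivity)
  have hkey : FN - montgomeryF m s -
      (x : ℂ) ^ (α : ℂ) * ((x : ℂ) ^ (((1 - t : ℝ) : ℂ) * I) * (gOne m Λ 0 / ((α : ℂ) + ((1 - t : ℝ) : ℂ) * I)) *
          ((Λ ^ (β - 1) * Real.exp (-1) / Real.Gamma β : ℝ) : ℂ)) =
      (1 / (2 * Real.pi) : ℂ) * ((x : ℂ) ^ (α : ℂ) * (P K₀ +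
        (∑ i ∈ (Finset.range (2 * K₀ + 1)).filter (fun i ↦ i ≠ K₀ ∧ i ≠ K₀ + 1), P i) +
        (P (K₀ + 1) - W₁) + (W₁ - MC * KER) +
        (MC * KER - MC * ((Λ ^ (β - 1) * Real.exp (-1) : ℝ) : ℂ) * ((2 * Real.pi / Real.Gamma β : ℝ) : ℂ))) - Q) := by
    have hπ : (2 * Real.pi : ℂ) ≠ 0 := by exact_mod_cast (mul_pos two_pos Real.pi_pos).ne'
    have hint : (∫ u in (-((K₀ : ℝ) + 1 / 2 + t))..((K₀ : ℝ) + 1 / 2 - t),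
        montgomeryF m (s + α + u * I) * ((x : ℂ) ^ ((α : ℂ) + u * I) / ((α : ℂ) + u * I))) =
        (x : ℂ) ^ (α : ℂ) * (P K₀ + P (K₀ + 1) +
          ∑ i ∈ (Finset.range (2 * K₀ + 1)).filter (fun i ↦ i ≠ K₀ ∧ i ≠ K₀ + 1), P i) := by
      rw [← hsplit]; exact hS1'
    have hπ2 : (2 * Real.pi : ℂ) ≠ 0 := by exact_mod_cast (mul_pos two_pos Real.pi_pos).ne'
    rw [one_div, inv_mul_eq_div, eq_div_iff hπ2, hQ, hint]
    linear_combination hmain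
  rw [hkey, norm_mul]
  have h2π : ‖(1 / (2 * Real.pi) : ℂ)‖ = 1 / (2 * Real.pi) := by
    rw [show (1 / (2 * Real.pi) : ℂ) = ((1 / (2 * Real.pi) : ℝ) : ℂ) by push_cast; ring, Complex.norm_real,
      Real.norm_of_nonneg (by positivity)]
  rw [h2π]
  rw [mul_left_comm (x ^ α) (1 / (2 * Real.pi))]
  refine mul_le_mul_of_nonneg_left ?_ (by positivity)
  refine (norm_sub_le _ _).trans ?_
  rw [norm_mul, hxn]
  have hw₀pow : w₀ ^ (2 - β) = (Λ ^ (-(1 / 2 : ℝ))) ^ (2 - β) := by rw [hw₀eq]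
  have hw₀pow' : w₀ ^ (-(max β 0)) = (Λ ^ (-(1 / 2 : ℝ))) ^ (-(max β 0)) := by rw [hw₀eq]
  rw [hw₀pow] at hWM
  rw [hw₀pow'] at hP1W
  have hsum : ‖P K₀‖ + ‖∑ i ∈ (Finset.range (2 * K₀ + 1)).filter (fun i ↦ i ≠ K₀ ∧ i ≠ K₀ + 1), P i‖ +
      ‖P (K₀ + 1) - W₁‖ + ‖W₁ - MC * KER‖ +
      ‖MC * KER - MC * ((Λ ^ (β - 1) * Real.exp (-1) : ℝ) : ℂ) * ((2 * Real.pi / Real.Gamma β : ℝ) : ℂ)‖ +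
      (1 / ((K₀ : ℝ) + 1 / 2 - t) + 1 / ((K₀ : ℝ) + 1 / 2 + t)) *
        (6 * (1 + Real.log ((N + 1 : ℕ) : ℝ)) + 2 * ((1 + 1 / Λ) / ((1 + 1 / Λ) - 1))) ≤
      4 * M₀ * (2 / Λ) ^ β₀ / (Λ * a) +
            8 * M₀ / Λ * (Λ ^ (montgomeryCoeff m 0) / a + 2 + a ^ (β₀ - 1) * (3 + 3 / (1 - β₀)) + L₀ / β₀) +
          Ms / Λ * (40 * Λ ^ (1 / 3 : ℝ) + 48 * Ls + 224) * (2 * (1 + Real.log K₀)) +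
          4 * M₁ * Λ ^ (β - 1) * (2 * Λ ^ (-(β / 2))) +
          (16 * L₁ + 32) * M₁ * (Λ ^ (-(1 / 2 : ℝ))) ^ (2 - β) +
          16 * M₁ / (Λ * 1) * (2 * (Λ ^ (-(1 / 2 : ℝ))) ^ (-(max β 0)) + 3 * L₁ + 14) +
          (1 / ((K₀ : ℝ) + 1 / 2 - t) + 1 / ((K₀ : ℝ) + 1 / 2 + t)) *
            (6 * (1 + Real.log ((N + 1 : ℕ) : ℝ)) + 2 * ((1 + 1 / Λ) / ((1 + 1 / Λ) - 1))) := by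
    linarith [hP0, hPS, hP1W, hWM, hKmain]
  calc x ^ α * ‖P K₀ + (∑ i ∈ (Finset.range (2 * K₀ + 1)).filter (fun i ↦ i ≠ K₀ ∧ i ≠ K₀ + 1), P i) +
          (P (K₀ + 1) - W₁) + (W₁ - MC * KER) +
          (MC * KER - MC * ((Λ ^ (β - 1) * Real.exp (-1) : ℝ) : ℂ) * ((2 * Real.pi / Real.Gamma β : ℝ) : ℂ))‖ + ‖Q‖
      ≤ x ^ α * (‖P K₀‖ + ‖∑ i ∈ (Finset.range (2 * K₀ + 1)).filter (fun i ↦ i ≠ K₀ ∧ i ≠ K₀ + 1), P i‖ +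
          ‖P (K₀ + 1) - W₁‖ + ‖W₁ - MC * KER‖ +
          ‖MC * KER - MC * ((Λ ^ (β - 1) * Real.exp (-1) : ℝ) : ℂ) * ((2 * Real.pi / Real.Gamma β : ℝ) : ℂ)‖) +
        x ^ α * (1 / ((K₀ : ℝ) + 1 / 2 - t) + 1 / ((K₀ : ℝ) + 1 / 2 + t)) *
          (6 * (1 + Real.log ((N + 1 : ℕ) : ℝ)) + 2 * ((1 + 1 / Λ) / ((1 + 1 / Λ) - 1))) := by
        refine add_le_add (mul_le_mul_of_nonneg_left ?_ hPE) hQn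
        exact (norm_add_le _ _).trans (add_le_add ((norm_add_le _ _).trans (add_le_add
          ((norm_add_le _ _).trans (add_le_add (norm_add_le _ _) le_rfl)) le_rfl)) le_rfl)
    _ = x ^ α * (‖P K₀‖ + ‖∑ i ∈ (Finset.range (2 * K₀ + 1)).filter (fun i ↦ i ≠ K₀ ∧ i ≠ K₀ + 1), P i‖ +
          ‖P (K₀ + 1) - W₁‖ + ‖W₁ - MC * KER‖ +
          ‖MC * KER - MC * ((Λ ^ (β - 1) * Real.exp (-1) : ℝ) : ℂ) * ((2 * Real.pi / Real.Gamma β : ℝ) : ℂ)‖ +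
          (1 / ((K₀ : ℝ) + 1 / 2 - t) + 1 / ((K₀ : ℝ) + 1 / 2 + t)) *
            (6 * (1 + Real.log ((N + 1 : ℕ) : ℝ)) + 2 * ((1 + 1 / Λ) / ((1 + 1 / Λ) - 1)))) := by ring
    _ ≤ _ := mul_le_mul_of_nonneg_left hsum hPE

omit h19 in
/-- **`|f|` at a real point `σ₀ ∈ (1, 2]`**: `(σ₀−1)^{β₀}/M₀ ≤ |f(σ₀)| ≤ (σ₀−1)^{β₀} M₀` (`β₀ = −b̂(0)`,
`M₀ = e^{A₁+A₂ log log 5}`). [cite: Montgomery1983, Lemma 4 (18), `k = 0`] -/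
theorem norm_montgomeryF_real_bounds {σ₀ : ℝ} (h1 : 1 < σ₀) (h2 : σ₀ ≤ 2) :
    (σ₀ - 1) ^ (-montgomeryCoeff m 0) * Real.exp (-(A₁ + A₂ * Real.log (Real.log 5))) ≤ ‖montgomeryF m σ₀‖ ∧
    ‖montgomeryF m σ₀‖ ≤ (σ₀ - 1) ^ (-montgomeryCoeff m 0) * Real.exp (A₁ + A₂ * Real.log (Real.log 5)) := by
  have hG := h18 0 (σ₀ : ℂ) (by simpa using h1) (by simpa using h2) (by simp)
  simp only [Int.cast_zero, zero_mul, sub_zero, abs_zero, zero_add] at hG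
  have hw0 : (σ₀ : ℂ) - 1 ≠ 0 := by
    intro h; have := congrArg Complex.re h; simp at this; linarith
  set G : ℂ := montgomeryPhi m σ₀ + (montgomeryCoeff m 0 : ℂ) * log ((σ₀ : ℂ) - 1) with hGdef
  have hnorm : ‖montgomeryF m σ₀‖ = (σ₀ - 1) ^ (-montgomeryCoeff m 0) * Real.exp G.re := by
    rw [norm_montgomeryF_eq m (by simpa using h1), show montgomeryPhi m σ₀ = G - (montgomeryCoeff m 0 : ℂ) *
      log ((σ₀ : ℂ) - 1) by rw [hGdef]; ring, sub_re, Real.exp_sub, re_ofReal_mul,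
      show ((σ₀ : ℂ) - 1) = ((σ₀ - 1 : ℝ) : ℂ) by push_cast; ring, log_ofReal_re,
      Real.rpow_def_of_pos (by linarith)]
    rw [div_eq_mul_inv, ← Real.exp_neg, mul_comm]; congr 1; ring
  have hGre : |G.re| ≤ A₁ + A₂ * Real.log (Real.log 5) := (abs_re_le_norm G).trans hG
  have hpos : 0 ≤ (σ₀ - 1) ^ (-montgomeryCoeff m 0) := Real.rpow_nonneg (by linarith) _
  rw [hnorm]
  exact ⟨mul_le_mul_of_nonneg_left (Real.exp_le_exp.2 (abs_le.1 hGre).1) hpos,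
    mul_le_mul_of_nonneg_left (Real.exp_le_exp.2 (abs_le.1 hGre).2) hpos⟩

omit h18 in
/-- **`Φ` varies little near a real point**: if `σ₀ ∈ (1+η, 2)` is real and `1 + η ≤ Re s < 2`,
`|Im s| ≤ 1/2` (`η > 0`), then `‖Φ(s) − Φ(σ₀)‖ ≤ (β₀/η + L₀)‖s − σ₀‖` (`L₀ = A₃ + A₄ log 5`), by the
mean value theorem along the segment with `‖Φ'(z)‖ ≤ β₀/|z − 1| + L₀`. [cite: Montgomery1983, Lemma 4 (19), `k = 0`] -/
theorem norm_phi_sub_real_le {σ₀ η : ℝ} (hη : 0 < η) (h1 : 1 + η ≤ σ₀) (h2 : σ₀ < 2) {s : ℂ}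
    (hs1 : 1 + η ≤ s.re) (hs2 : s.re < 2) (hsi : |s.im| ≤ 1 / 2) :
    ‖montgomeryPhi m s - montgomeryPhi m σ₀‖ ≤
      ((-montgomeryCoeff m 0) / η + (A₃ + A₄ * Real.log 5)) * ‖s - σ₀‖ := by
  -- the segment lies in the box `T = {1 + η ≤ Re z < 2, |Im z| ≤ 1/2}`, which is convex
  set T : Set ℂ := {z : ℂ | 1 + η ≤ z.re} ∩ {z : ℂ | z.re < 2} ∩ ({z : ℂ | -(1 / 2) ≤ z.im} ∩ {z : ℂ | z.im ≤ 1 / 2})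
    with hT
  have hTc : Convex ℝ T :=
    ((convex_halfSpace_re_ge _).inter (convex_halfSpace_re_lt _)).inter
      ((convex_halfSpace_im_ge _).inter (convex_halfSpace_im_le _))
  have hσT : (σ₀ : ℂ) ∈ T := by
    simp only [hT, mem_inter_iff, mem_setOf_eq, ofReal_re, ofReal_im]
    exact ⟨⟨h1, h2⟩, by norm_num, by norm_num⟩
  have hsT : s ∈ T := by
    simp only [hT, mem_inter_iff, mem_setOf_eq]
    exact ⟨⟨hs1, hs2⟩, (abs_le.1 hsi).1, (abs_le.1 hsi).2⟩
  have hderiv : ∀ z ∈ T, HasDerivWithinAt (montgomeryPhi m) (montgomeryPhiDeriv m z) T z := by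
    intro z hz
    simp only [hT, mem_inter_iff, mem_setOf_eq] at hz
    exact (hasDerivAt_montgomeryPhi m (by linarith [hz.1.1]) hz.1.2).hasDerivWithinAt
  have hbound : ∀ z ∈ T, ‖montgomeryPhiDeriv m z‖ ≤ (-montgomeryCoeff m 0) / η + (A₃ + A₄ * Real.log 5) := by
    intro z hz
    simp only [hT, mem_inter_iff, mem_setOf_eq] at hz
    have h := h19 0 z (by linarith [hz.1.1]) hz.1.2.le (by simpa using abs_le.2 ⟨hz.2.1, hz.2.2⟩)
    simp only [Int.cast_zero, zero_mul, sub_zero, abs_zero, zero_add] at h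
    have hz1 : η ≤ ‖z - 1‖ := by
      calc η ≤ |(z - 1).re| := by rw [sub_re, one_re, abs_of_pos (by linarith [hz.1.1])]; linarith [hz.1.1]
        _ ≤ ‖z - 1‖ := abs_re_le_norm _
    have hβ₀ : 0 < -montgomeryCoeff m 0 := by linarith [(montgomeryCoeff_zero_bounds m).2]
    calc ‖montgomeryPhiDeriv m z‖
        = ‖(montgomeryPhiDeriv m z + (montgomeryCoeff m 0 : ℂ) / (z - 1)) - (montgomeryCoeff m 0 : ℂ) / (z - 1)‖ := by
          rw [add_sub_cancel_right]
      _ ≤ ‖montgomeryPhiDeriv m z + (montgomeryCoeff m 0 : ℂ) / (z - 1)‖ + ‖(montgomeryCoeff m 0 : ℂ) / (z - 1)‖ :=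
          norm_sub_le _ _
      _ ≤ (A₃ + A₄ * Real.log 5) + (-montgomeryCoeff m 0) / η := by
          refine add_le_add h ?_
          rw [norm_div, norm_real, Real.norm_eq_abs, abs_of_neg (montgomeryCoeff_zero_bounds m).2]
          exact div_le_div_of_nonneg_left hβ₀.le hη hz1
      _ = _ := add_comm _ _
  exact hTc.norm_image_sub_le_of_norm_hasDerivWithin_le hderiv hbound hσT hsT

omit h18 h19 in
/-- **The centre of the Rouché disc**: for `C, a ≠ 0` and `Λ > 0`, `s₀ = 1 − log(−C/a)/Λ` satisfies
`a e^{−Λ(s₀−1)} = −C`, `Re s₀ = 1 − log(‖C‖/‖a‖)/Λ` and `|Im s₀| ≤ π/Λ`. [folklore] -/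
theorem model_center {Λ : ℝ} (hΛ : 0 < Λ) {C a : ℂ} (hC : C ≠ 0) (ha : a ≠ 0) :
    a * exp (-(Λ : ℂ) * ((1 - log (-C / a) / Λ) - 1)) = -C ∧
    (1 - log (-C / a) / Λ : ℂ).re = 1 - Real.log (‖C‖ / ‖a‖) / Λ ∧
    |(1 - log (-C / a) / Λ : ℂ).im| ≤ Real.pi / Λ := by
  have hLc : (Λ : ℂ) ≠ 0 := ofReal_ne_zero.2 hΛ.ne'
  have hCa : -C / a ≠ 0 := div_ne_zero (neg_ne_zero.2 hC) ha
  refine ⟨?_, ?_, ?_⟩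
  · rw [show -(Λ : ℂ) * ((1 - log (-C / a) / Λ) - 1) = log (-C / a) by field_simp; ring, exp_log hCa]
    field_simp
  · simp only [sub_re, one_re, div_ofReal_re, log_re, norm_div, norm_neg]
  · simp only [sub_im, one_im, div_ofReal_im, log_im, zero_sub, abs_neg, abs_div, abs_of_pos hΛ]
    exact div_le_div_of_nonneg_right (abs_arg_le_pi _) hΛ.le

omit h18 h19 in
/-- `‖x^w‖ = e^{Λ Re w}` and `x^w = e^{Λ w}` for `x > 0`, `Λ = log x`. [folklore] -/
theorem norm_ofReal_cpow_eq_exp {x : ℝ} (hx : 0 < x) (w : ℂ) : ‖(x : ℂ) ^ w‖ = Real.exp (Real.log x * w.re) := by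
  rw [ofReal_cpow_eq_exp hx, norm_exp]; simp

omit h18 h19 in
/-- The `k = 0` error bound is decreasing in `a`. [folklore] -/
theorem pieceZeroBound_antitone {M₀ L₀ Λ β₀ b a a' : ℝ} (hM₀ : 0 ≤ M₀) (hΛ : 0 < Λ)
    (hβ₁ : β₀ < 1) (ha' : 0 < a') (haa : a' ≤ a) :
    4 * M₀ * (2 / Λ) ^ β₀ / (Λ * a) + 8 * M₀ / Λ * (Λ ^ b / a + 2 + a ^ (β₀ - 1) * (3 + 3 / (1 - β₀)) + L₀ / β₀) ≤
    4 * M₀ * (2 / Λ) ^ β₀ / (Λ * a') + 8 * M₀ / Λ * (Λ ^ b / a' + 2 + a' ^ (β₀ - 1) * (3 + 3 / (1 - β₀)) + L₀ / β₀) := by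
  have ha : 0 < a := ha'.trans_le haa
  have h1 : a ^ (β₀ - 1) ≤ a' ^ (β₀ - 1) := Real.rpow_le_rpow_of_nonpos ha' haa (by linarith)
  have h2 : 1 / a ≤ 1 / a' := one_div_le_one_div_of_le ha' haa
  have hb1 : 0 < 1 - β₀ := by linarith
  have hP : 0 ≤ (2 / Λ) ^ β₀ := Real.rpow_nonneg (by positivity) _
  have hQ : 0 ≤ Λ ^ b := Real.rpow_nonneg hΛ.le _
  refine add_le_add (div_le_div_of_nonneg_left (by positivity) (by positivity) (by nlinarith)) ?_
  refine mul_le_mul_of_nonneg_left ?_ (by positivity)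
  have h3 : Λ ^ b / a ≤ Λ ^ b / a' := div_le_div_of_nonneg_left hQ ha' haa
  have h4 : a ^ (β₀ - 1) * (3 + 3 / (1 - β₀)) ≤ a' ^ (β₀ - 1) * (3 + 3 / (1 - β₀)) :=
    mul_le_mul_of_nonneg_right h1 (by positivity)
  linarith

set_option maxHeartbeats 1600000 in
/-- **Montgomery's theorem for the twisted section, quantitative core.** For the twist `a = a_m`
with `κ = b̂(1) − b̂(0) − 1 > 0` and `N` so large that the listed inequalities in `Λ = log(N + 1/2)` hold,
`F_N(s) = Σ_{n ≤ N} a(n) n^{-s}` has a zero with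
`Re s > 1 + (κ log Λ − β₀ log(κ log Λ) − K − 1/2)/Λ`: Rouché (in the form
`exists_zero_of_norm_sub_exp_add_const_lt`) applied to `F_N` against the model `a e^{−Λ(s−1)} + C`,
`C = f(1 + κ log Λ/Λ)`, on the disc of radius `1/(2Λ)` about a zero `s₀` of the model.
[cite: Montgomery1983, §4 (24) and the concluding paragraph] -/
theorem exists_twistedPartialSum_zero (hA₂ : 0 ≤ A₂) (hA₃ : 0 ≤ A₃) (hA₄ : 0 ≤ A₄)
    (hκ : 0 < montgomeryCoeff m 1 - montgomeryCoeff m 0 - 1) {N : ℕ} (hN : 1 ≤ N)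
    {x Λ κ β β₀ u M₁ L₁ M₀ L₀ Kc R amin Ms Ls REST : ℝ} {K₀ : ℕ}
    (hxdef : x = (N : ℝ) + 1 / 2) (hΛdef : Λ = Real.log x)
    (hκdef : κ = montgomeryCoeff m 1 - montgomeryCoeff m 0 - 1) (hβdef : β = montgomeryCoeff m 1)
    (hβ₀def : β₀ = -montgomeryCoeff m 0) (hudef : u = κ * Real.log Λ / Λ)
    (hM₁def : M₁ = Real.exp (A₁ + A₂ * Real.log (Real.log 6))) (hL₁def : L₁ = A₃ + A₄ * Real.log 6)
    (hM₀def : M₀ = Real.exp (A₁ + A₂ * Real.log (Real.log 5))) (hL₀def : L₀ = A₃ + A₄ * Real.log 5)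
    (hKcdef : Kc = (A₁ + A₂ * Real.log (Real.log 5)) + (A₁ + A₂ * Real.log (Real.log 6)) +
      |Real.log (Real.Gamma β)| + Real.log 2)
    (hRdef : R = (β₀ * Real.log (κ * Real.log Λ) + Kc + Real.pi + 1 / 2) / Λ)
    (hamindef : amin = (u / 2 - 1 / Λ) / 2) (hK₀def : K₀ = ⌈Λ ^ 3⌉₊)
    (hMsdef : Ms = Real.exp (A₁ + A₂ * Real.log (Real.log ((K₀ : ℝ) + 5))))
    (hLsdef : Ls = A₃ + A₄ * Real.log ((K₀ : ℝ) + 5))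
    (hRESTdef : REST = Ms / Λ * (40 * Λ ^ (1 / 3 : ℝ) + 48 * Ls + 224) * (2 * (1 + Real.log K₀)) +
          4 * M₁ * Λ ^ (β - 1) * (2 * Λ ^ (-(β / 2))) +
          (16 * L₁ + 32) * M₁ * (Λ ^ (-(1 / 2 : ℝ))) ^ (2 - β) +
          16 * M₁ / (Λ * 1) * (2 * (Λ ^ (-(1 / 2 : ℝ))) ^ (-(max β 0)) + 3 * L₁ + 14) +
          2 / Λ ^ 3 * (6 * (1 + (Λ + 1)) + 2 * (Λ + 1)))
    (hΛ4 : 4 ≤ Λ) (hu2 : u ≤ 1 / 2) (hκl : 1 ≤ κ * Real.log Λ) (hRu : R ≤ u / 2)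
    (hπ4 : (Real.pi + 1 / 2) / Λ ≤ 1 / 4) (hπa : (Real.pi + 1 / 2) / Λ ≤ amin) (hΛa : 1 / Λ ≤ amin)
    (hu34 : 3 * u / 4 ≤ 1 / 2) (hLw : L₁ * Λ ^ (-(1 / 2 : ℝ)) ≤ 1)
    (hC3 : (β₀ / (u / 2) + L₀) * R ≤ 1 / 80) (hC4 : Real.exp (1 / 2) * R / (3 / 4) ≤ 1 / 40)
    (hC1 : Real.exp 1 / (2 * Real.pi) * (4 * M₀ * (2 / Λ) ^ β₀ / (Λ * amin) +
        8 * M₀ / Λ * (Λ ^ (montgomeryCoeff m 0) / amin + 2 + amin ^ (β₀ - 1) * (3 + 3 / (1 - β₀)) + L₀ / β₀)) ≤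
      u ^ β₀ / (40 * M₀))
    (hC2 : 2 * Real.exp (3 / 2) * Real.Gamma β * M₁ * Λ ^ (1 - β) * (1 / (2 * Real.pi)) * REST ≤ 1 / 40) :
    ∃ s : ℂ, twistedPartialSum (fun n ↦ (montgomeryTwist m n : ℂ)) N s = 0 ∧
      1 + (κ * Real.log Λ - β₀ * Real.log (κ * Real.log Λ) - Kc - 1 / 2) / Λ < s.re := by
  -- basic positivity
  have hx1 : (1 : ℝ) < x := by rw [hxdef]; have := (Nat.one_le_cast (α := ℝ)).2 hN; linarith
  have hx0 : 0 < x := by linarith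
  have hΛ0 : 0 < Λ := by linarith
  have hΛ2 : 2 ≤ Λ := by linarith
  have hlogΛ : 0 < Real.log Λ := Real.log_pos (by linarith)
  have hκ0 : 0 < κ := by rw [hκdef]; exact hκ
  have hu0 : 0 < u := by rw [hudef]; positivity
  have hβlo : 1 / 2 ≤ β := by rw [hβdef]; exact (montgomeryCoeff_one_bounds m).1
  have hβpos : 0 < β := by linarith
  have hβ1 : β < 1 := by rw [hβdef]; exact (abs_lt.1 (abs_montgomeryCoeff_lt_one m 1)).2
  have hβ₀0 : 0 < β₀ := by rw [hβ₀def]; linarith [(montgomeryCoeff_zero_bounds m).2]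
  have hβ₀1 : β₀ < 1 := by rw [hβ₀def]; linarith [(montgomeryCoeff_zero_bounds m).1]
  have hκβ : κ = β + β₀ - 1 := by rw [hκdef, hβdef, hβ₀def]; ring
  have hM₀ : 0 < M₀ := by rw [hM₀def]; exact Real.exp_pos _
  have hM₁ : 0 < M₁ := by rw [hM₁def]; exact Real.exp_pos _
  have hΓ : 0 < Real.Gamma β := Real.Gamma_pos_of_pos hβpos
  have hκlog : 0 < κ * Real.log Λ := by positivity
  -- the real anchor `s₀₀ = 1 + u` and `C = f(s₀₀)`
  obtain ⟨s₀₀, hs₀₀⟩ : ∃ s₀₀ : ℂ, s₀₀ = ((1 + u : ℝ) : ℂ) := ⟨_, rfl⟩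
  obtain ⟨C, hC⟩ : ∃ C : ℂ, C = montgomeryF m s₀₀ := ⟨_, rfl⟩
  have hCb := norm_montgomeryF_real_bounds m h18 (σ₀ := 1 + u) (by linarith) (by linarith)
  rw [show (1 + u - 1 : ℝ) = u by ring] at hCb
  have hCb' : u ^ β₀ * Real.exp (-(A₁ + A₂ * Real.log (Real.log 5))) ≤ ‖C‖ ∧ ‖C‖ ≤ u ^ β₀ * M₀ := by
    rw [hM₀def, hβ₀def, hC, hs₀₀]; exact hCb
  have hClo : u ^ β₀ / M₀ ≤ ‖C‖ := by
    rw [hM₀def, div_eq_mul_inv, ← Real.exp_neg]; exact hCb'.1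
  have hCpos : 0 < ‖C‖ := lt_of_lt_of_le (by positivity) hClo
  have hC0 : C ≠ 0 := norm_pos_iff.1 hCpos
  -- `D = g₁(0)`, `z₁ = 1 + 1/Λ + i`, the coefficient `a`
  obtain ⟨D, hD⟩ : ∃ D : ℂ, D = gOne m Λ 0 := ⟨_, rfl⟩
  obtain ⟨hD1, hD2⟩ := norm_gOne_le m h18 hΛ2 (v := 0) (by norm_num)
  rw [← hD] at hD1 hD2
  have hDpos : 0 < ‖D‖ := lt_of_lt_of_le (Real.exp_pos _) hD2
  have hDlo : 1 / M₁ ≤ ‖D‖ := by rw [hM₁def, one_div, ← Real.exp_neg]; exact hD2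
  have hD1' : ‖D‖ ≤ M₁ := by rw [hM₁def]; exact hD1
  obtain ⟨z₁, hz₁⟩ : ∃ z₁ : ℂ, z₁ = zline Λ 1 := ⟨_, rfl⟩
  have hz₁s : z₁ - s₀₀ = ((1 / Λ - u : ℝ) : ℂ) + I := by
    simp only [hz₁, hs₀₀, zline]; push_cast; ring
  have hzs_lo : 1 ≤ ‖z₁ - s₀₀‖ := by
    calc (1 : ℝ) = |(z₁ - s₀₀).im| := by rw [hz₁s]; simp
      _ ≤ _ := abs_im_le_norm _
  have hzs_hi : ‖z₁ - s₀₀‖ ≤ 2 := by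
    rw [hz₁s]
    refine (norm_add_le _ _).trans ?_
    rw [norm_real, norm_I, Real.norm_eq_abs]
    have h4 : 1 / Λ ≤ 1 / 4 := one_div_le_one_div_of_le (by norm_num) hΛ4
    have h5 : 0 < 1 / Λ := one_div_pos.2 hΛ0
    have : |1 / Λ - u| ≤ 1 := by rw [abs_le]; constructor <;> linarith
    linarith
  have hzs0 : z₁ - s₀₀ ≠ 0 := by
    intro h; rw [h, norm_zero] at hzs_lo; linarith
  have hxI : ‖(x : ℂ) ^ I‖ = 1 := by rw [norm_ofReal_cpow_eq_exp hx0]; simp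
  obtain ⟨a, ha⟩ : ∃ a : ℂ, a = D * ((Λ ^ (β - 1) : ℝ) : ℂ) * (x : ℂ) ^ I / ((Real.Gamma β : ℂ) * (z₁ - s₀₀)) := ⟨_, rfl⟩
  have hanorm : ‖a‖ = ‖D‖ * Λ ^ (β - 1) / (Real.Gamma β * ‖z₁ - s₀₀‖) := by
    rw [ha, norm_div, norm_mul, norm_mul, norm_mul, hxI, mul_one, Complex.norm_real, Complex.norm_real,
      Real.norm_of_nonneg (Real.rpow_nonneg hΛ0.le _), Real.norm_of_nonneg hΓ.le]
  have hapos : 0 < ‖a‖ := by rw [hanorm]; positivity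
  have ha0 : a ≠ 0 := norm_pos_iff.1 hapos
  have hLβ : 0 ≤ Λ ^ (β - 1) := Real.rpow_nonneg hΛ0.le _
  have halo : Λ ^ (β - 1) / (M₁ * Real.Gamma β * 2) ≤ ‖a‖ := by
    rw [hanorm]
    calc Λ ^ (β - 1) / (M₁ * Real.Gamma β * 2) = (1 / M₁ * Λ ^ (β - 1)) / (Real.Gamma β * 2) := by
          field_simp
      _ ≤ (‖D‖ * Λ ^ (β - 1)) / (Real.Gamma β * 2) :=
          div_le_div_of_nonneg_right (mul_le_mul_of_nonneg_right hDlo hLβ) (by positivity)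
      _ ≤ (‖D‖ * Λ ^ (β - 1)) / (Real.Gamma β * ‖z₁ - s₀₀‖) :=
          div_le_div_of_nonneg_left (by positivity) (by positivity) (mul_le_mul_of_nonneg_left hzs_hi hΓ.le)
  have hahi : ‖a‖ ≤ M₁ * Λ ^ (β - 1) / Real.Gamma β := by
    rw [hanorm]
    calc ‖D‖ * Λ ^ (β - 1) / (Real.Gamma β * ‖z₁ - s₀₀‖) ≤ (M₁ * Λ ^ (β - 1)) / (Real.Gamma β * ‖z₁ - s₀₀‖) :=
          div_le_div_of_nonneg_right (mul_le_mul_of_nonneg_right hD1' hLβ) (by positivity)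
      _ ≤ (M₁ * Λ ^ (β - 1)) / (Real.Gamma β * 1) :=
          div_le_div_of_nonneg_left (by positivity) (by positivity) (mul_le_mul_of_nonneg_left hzs_lo hΓ.le)
      _ = _ := by rw [mul_one]
  -- the centre `s₀`
  obtain ⟨hmodel, hs₀re, hs₀im⟩ := model_center hΛ0 hC0 ha0
  obtain ⟨s₀, hs₀⟩ : ∃ s₀ : ℂ, s₀ = 1 - log (-C / a) / Λ := ⟨_, rfl⟩
  rw [← hs₀] at hmodel hs₀re hs₀im
  -- `log(‖C‖/‖a‖)` against `κ log Λ − β₀ log(κ log Λ)`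
  have hlogu : Real.log u = Real.log (κ * Real.log Λ) - Real.log Λ := by
    rw [hudef, Real.log_div hκlog.ne' hΛ0.ne']
  have hlogM₀ : Real.log M₀ = A₁ + A₂ * Real.log (Real.log 5) := by rw [hM₀def, Real.log_exp]
  have hlogM₁ : Real.log M₁ = A₁ + A₂ * Real.log (Real.log 6) := by rw [hM₁def, Real.log_exp]
  have hlogCa_hi : Real.log (‖C‖ / ‖a‖) ≤ -(κ * Real.log Λ - β₀ * Real.log (κ * Real.log Λ)) + Kc := by
    rw [Real.log_div hCpos.ne' hapos.ne']
    have h1 : Real.log ‖C‖ ≤ β₀ * Real.log u + (A₁ + A₂ * Real.log (Real.log 5)) := by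
      have := Real.log_le_log hCpos hCb'.2
      rwa [Real.log_mul (by positivity) hM₀.ne', Real.log_rpow hu0, hlogM₀] at this
    have h2 : (β - 1) * Real.log Λ - ((A₁ + A₂ * Real.log (Real.log 6)) + Real.log (Real.Gamma β) + Real.log 2) ≤
        Real.log ‖a‖ := by
      have := Real.log_le_log (by positivity) halo
      rwa [Real.log_div (by positivity) (by positivity), Real.log_rpow hΛ0, Real.log_mul (by positivity) (by norm_num),
        Real.log_mul hM₁.ne' hΓ.ne', hlogM₁] at this
    have h3 : Real.log (Real.Gamma β) ≤ |Real.log (Real.Gamma β)| := le_abs_self _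
    rw [hlogu] at h1
    rw [hKcdef]
    have h5 : β₀ * (Real.log (κ * Real.log Λ) - Real.log Λ) - (β - 1) * Real.log Λ =
        -(κ * Real.log Λ - β₀ * Real.log (κ * Real.log Λ)) := by rw [hκβ]; ring
    linarith
  have hlogCa_lo : -(κ * Real.log Λ - β₀ * Real.log (κ * Real.log Λ)) - Kc ≤ Real.log (‖C‖ / ‖a‖) := by
    rw [Real.log_div hCpos.ne' hapos.ne']
    have h1 : β₀ * Real.log u - (A₁ + A₂ * Real.log (Real.log 5)) ≤ Real.log ‖C‖ := by
      have := Real.log_le_log (by positivity) hClo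
      rwa [Real.log_div (by positivity) hM₀.ne', Real.log_rpow hu0, hlogM₀] at this
    have h2 : Real.log ‖a‖ ≤ (A₁ + A₂ * Real.log (Real.log 6)) + (β - 1) * Real.log Λ - Real.log (Real.Gamma β) := by
      have := Real.log_le_log hapos hahi
      rwa [Real.log_div (by positivity) hΓ.ne', Real.log_mul hM₁.ne' (by positivity), Real.log_rpow hΛ0,
        hlogM₁] at this
    have h3 : -Real.log (Real.Gamma β) ≤ |Real.log (Real.Gamma β)| := neg_le_abs _
    have h4 : 0 ≤ Real.log 2 := Real.log_nonneg one_le_two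
    rw [hlogu] at h1
    rw [hKcdef]
    have h5 : β₀ * (Real.log (κ * Real.log Λ) - Real.log Λ) - (β - 1) * Real.log Λ =
        -(κ * Real.log Λ - β₀ * Real.log (κ * Real.log Λ)) := by rw [hκβ]; ring
    linarith
  have hres₀_lo : 1 + (κ * Real.log Λ - β₀ * Real.log (κ * Real.log Λ) - Kc) / Λ ≤ s₀.re := by
    rw [hs₀re, show 1 + (κ * Real.log Λ - β₀ * Real.log (κ * Real.log Λ) - Kc) / Λ =
      1 - (-(κ * Real.log Λ - β₀ * Real.log (κ * Real.log Λ)) + Kc) / Λ by ring]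
    gcongr
  have hres₀_hi : s₀.re ≤ 1 + (κ * Real.log Λ - β₀ * Real.log (κ * Real.log Λ) + Kc) / Λ := by
    rw [hs₀re, show 1 + (κ * Real.log Λ - β₀ * Real.log (κ * Real.log Λ) + Kc) / Λ =
      1 - (-(κ * Real.log Λ - β₀ * Real.log (κ * Real.log Λ)) - Kc) / Λ by ring]
    gcongr
  have hure : s₀₀.re = 1 + u := by simp [hs₀₀]
  have huκ : u = κ * Real.log Λ / Λ := hudef
  -- distance from `s₀₀` on the closed disc
  have hdist : ∀ s ∈ Metric.closedBall s₀ (1 / (2 * Λ)), ‖s - s₀₀‖ ≤ R := by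
    intro s hs
    rw [Metric.mem_closedBall, dist_eq_norm] at hs
    have h1 : ‖s₀ - s₀₀‖ ≤ |(s₀ - s₀₀).re| + |(s₀ - s₀₀).im| := Complex.norm_le_abs_re_add_abs_im _
    have h2 : |(s₀ - s₀₀).re| ≤ (β₀ * Real.log (κ * Real.log Λ) + Kc) / Λ := by
      rw [sub_re, hure, abs_le]
      constructor
      · have : (κ * Real.log Λ - β₀ * Real.log (κ * Real.log Λ) - Kc) / Λ - u ≤ s₀.re - (1 + u) := by linarith
        refine le_trans (le_of_eq ?_) this
        rw [huκ]; field_simp; ring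
      · have : s₀.re - (1 + u) ≤ (κ * Real.log Λ - β₀ * Real.log (κ * Real.log Λ) + Kc) / Λ - u := by linarith
        refine this.trans ?_
        have hL0 : 0 ≤ β₀ * Real.log (κ * Real.log Λ) := mul_nonneg hβ₀0.le (Real.log_nonneg hκl)
        rw [huκ, div_sub_div_same, div_le_div_iff_of_pos_right hΛ0]
        linarith
    have h3 : |(s₀ - s₀₀).im| ≤ Real.pi / Λ := by rw [sub_im]; simpa [hs₀₀] using hs₀im
    calc ‖s - s₀₀‖ ≤ ‖s - s₀‖ + ‖s₀ - s₀₀‖ := norm_sub_le_norm_sub_add_norm_sub _ _ _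
      _ ≤ 1 / (2 * Λ) + ((β₀ * Real.log (κ * Real.log Λ) + Kc) / Λ + Real.pi / Λ) := by
          refine add_le_add hs (h1.trans (add_le_add h2 h3))
      _ = R := by rw [hRdef]; field_simp; ring
  have hR0 : 0 ≤ R := le_trans (norm_nonneg _) (hdist s₀ (Metric.mem_closedBall_self (by positivity)))
  -- geometry of the disc
  have hamin0 : 0 < amin := lt_of_lt_of_le (one_div_pos.2 hΛ0) hΛa
  have hu2Λ : 2 / Λ ≤ u / 2 - 1 / Λ := by
    have h := hΛa
    rw [hamindef, le_div_iff₀ (by norm_num : (0:ℝ) < 2)] at h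
    have : 2 / Λ = 1 / Λ * 2 := by ring
    linarith
  have hgeom : ∀ s ∈ Metric.closedBall s₀ (1 / (2 * Λ)),
      1 + u / 2 ≤ s.re ∧ s.re ≤ 1 + 3 * u / 2 ∧ |s.im| ≤ (Real.pi + 1 / 2) / Λ := by
    intro s hs
    have hd := hdist s hs
    rw [Metric.mem_closedBall, dist_eq_norm] at hs
    have h1 : |(s - s₀₀).re| ≤ R := (abs_re_le_norm _).trans hd
    rw [sub_re, hure, abs_le] at h1
    have h2 : |s.im| ≤ ‖s - s₀‖ + |s₀.im| := by
      calc |s.im| = |(s - s₀).im + s₀.im| := by simp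
        _ ≤ |(s - s₀).im| + |s₀.im| := abs_add_le _ _
        _ ≤ _ := add_le_add (abs_im_le_norm _) le_rfl
    refine ⟨by linarith, by linarith, h2.trans ?_⟩
    calc ‖s - s₀‖ + |s₀.im| ≤ 1 / (2 * Λ) + Real.pi / Λ := add_le_add hs hs₀im
      _ = (Real.pi + 1 / 2) / Λ := by field_simp; ring
  -- `a e^{-Λ(s-1)} = -C e^{-Λ(s-s₀)}` and its size on the disc
  have hae : ∀ s : ℂ, a * exp (-(Λ : ℂ) * (s - 1)) = -C * exp (-(Λ : ℂ) * (s - s₀)) := by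
    intro s
    rw [← hmodel, mul_assoc, ← exp_add]; congr 1; ring
  have hae_norm : ∀ s ∈ Metric.closedBall s₀ (1 / (2 * Λ)), ‖a * exp (-(Λ : ℂ) * (s - 1))‖ ≤ ‖C‖ * Real.exp (1 / 2) := by
    intro s hs
    rw [Metric.mem_closedBall, dist_eq_norm] at hs
    rw [hae, norm_mul, norm_neg, norm_exp]
    refine mul_le_mul_of_nonneg_left (Real.exp_le_exp.2 ?_) (norm_nonneg _)
    have h1 : |(s - s₀).re| ≤ 1 / (2 * Λ) := (abs_re_le_norm _).trans hs
    have h2 : (-(Λ : ℂ) * (s - s₀)).re = -Λ * (s - s₀).re := by simp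
    rw [h2]
    have h3 := mul_le_mul_of_nonneg_left (abs_le.1 h1).1 hΛ0.le
    calc -Λ * (s - s₀).re ≤ Λ * (1 / (2 * Λ)) := by linarith only [h3]
      _ = 1 / 2 := by field_simp
  -- `x^α ≤ 2 e^{3/2} Γ M₁ ‖C‖ Λ^{1-β}` on the disc (`α = 1 + 1/Λ − σ`)
  have hxα : ∀ s ∈ Metric.closedBall s₀ (1 / (2 * Λ)),
      x ^ (1 + 1 / Λ - s.re) ≤ 2 * Real.exp (3 / 2) * Real.Gamma β * M₁ * ‖C‖ * Λ ^ (1 - β) := by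
    intro s hs
    have h1 := hae_norm s hs
    rw [norm_mul, norm_exp, show (-(Λ : ℂ) * (s - 1)).re = -Λ * (s.re - 1) by simp] at h1
    -- `x^{1+1/Λ-σ} = e · e^{-Λ(σ-1)}`
    have hxpow : x ^ (1 + 1 / Λ - s.re) = Real.exp 1 * Real.exp (-Λ * (s.re - 1)) := by
      rw [Real.rpow_def_of_pos hx0, ← hΛdef, ← Real.exp_add]; congr 1
      rw [mul_sub, mul_add, mul_one_div_cancel hΛ0.ne']; ring
    rw [hxpow]
    have h2 : Real.exp (-Λ * (s.re - 1)) ≤ ‖C‖ * Real.exp (1 / 2) / ‖a‖ := by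
      rw [le_div_iff₀ hapos]; linarith only [h1]
    have h3 : ‖C‖ * Real.exp (1 / 2) / ‖a‖ ≤ ‖C‖ * Real.exp (1 / 2) / (Λ ^ (β - 1) / (M₁ * Real.Gamma β * 2)) :=
      div_le_div_of_nonneg_left (by positivity) (by positivity) halo
    have h4 : Λ ^ (1 - β) = 1 / Λ ^ (β - 1) := by
      rw [one_div, ← Real.rpow_neg hΛ0.le]; congr 1; ring
    calc Real.exp 1 * Real.exp (-Λ * (s.re - 1)) ≤ Real.exp 1 * (‖C‖ * Real.exp (1 / 2) / (Λ ^ (β - 1) / (M₁ * Real.Gamma β * 2))) :=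
          mul_le_mul_of_nonneg_left (h2.trans h3) (Real.exp_pos 1).le
      _ = 2 * (Real.exp 1 * Real.exp (1 / 2)) * Real.Gamma β * M₁ * ‖C‖ * Λ ^ (1 - β) := by
          rw [h4]; field_simp
      _ = _ := by rw [← Real.exp_add]; norm_num
  -- `F_N` is entire
  have hFdiff : Differentiable ℂ (twistedPartialSum (fun n ↦ (montgomeryTwist m n : ℂ)) N) := by
    have : twistedPartialSum (fun n ↦ (montgomeryTwist m n : ℂ)) N =
        fun s ↦ ∑ n ∈ Finset.Icc 1 N, (montgomeryTwist m n : ℂ) * (n : ℂ) ^ (-s) := rfl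
    rw [this]
    refine Differentiable.fun_sum fun n hn ↦ ?_
    have hn0 : (n : ℂ) ≠ 0 := by
      rw [Finset.mem_Icc] at hn; exact_mod_cast (show n ≠ 0 by omega)
    exact (differentiable_id.neg.const_cpow (Or.inl hn0)).const_mul _
  -- the closeness estimate on the closed disc
  have hclose : ∀ s ∈ Metric.closedBall s₀ (1 / (2 * Λ)),
      ‖twistedPartialSum (fun n ↦ (montgomeryTwist m n : ℂ)) N s - (a * exp (-(Λ : ℂ) * (s - 1)) + C)‖ < ‖C‖ / 8 := by
    intro s hs
    obtain ⟨hσlo, hσhi, htb⟩ := hgeom s hs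
    have hd := hdist s hs
    set σ := s.re with hσ
    set t := s.im with ht
    set α : ℝ := 1 + 1 / Λ - σ with hαdef
    have hαneg : α < 0 := by rw [hαdef]; linarith
    have hαabs : |α| = σ - 1 - 1 / Λ := by rw [abs_of_neg hαneg, hαdef]; ring
    have has_lo : amin ≤ |α| / 2 := by rw [hαabs, hamindef]; linarith
    have has_hi : |α| / 2 ≤ 1 / 2 := by rw [hαabs]; linarith only [hσhi, hu34, one_div_pos.2 hΛ0]
    have ht4 : |t| ≤ 1 / 4 := htb.trans hπ4
    have hta : |t| ≤ |α| / 2 := htb.trans (hπa.trans has_lo)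
    have ha1 : 1 / Λ ≤ |α| / 2 := hΛa.trans has_lo
    -- (1) the approximate formula
    have hA1 := norm_partialSum_sub_main_le m h18 h19 hA₂ hA₃ hA₄ hN (by rw [← hxdef, ← hΛdef]; exact hΛ4)
      (by rw [← hxdef, ← hΛdef, ← hL₁def]; exact hLw) (s := s) (by rw [← hxdef, ← hΛdef]; linarith)
      ht4 (by rw [← hxdef, ← hΛdef]; exact hta) (by rw [← hxdef, ← hΛdef]; exact ha1)
      (by rw [← hxdef, ← hΛdef]; exact has_hi)
    dsimp only at hA1
    rw [← hxdef] at hA1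
    rw [← hΛdef, ← hβdef, ← hβ₀def, ← hK₀def, ← hM₁def, ← hL₁def, ← hM₀def, ← hL₀def, ← hMsdef, ← hLsdef,
      ← hσ, ← ht, ← hαdef, ← hD] at hA1
    -- (2) bounding the error of (1)
    have hxα1 : x ^ α ≤ 1 := Real.rpow_le_one_of_one_le_of_nonpos hx1.le hαneg.le
    have hxα2 := hxα s hs
    rw [← hσ, ← hαdef] at hxα2
    have hB₀ := pieceZeroBound_antitone (M₀ := M₀) (L₀ := L₀) (b := montgomeryCoeff m 0) hM₀.le hΛ0 hβ₀1 hamin0 has_lo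
    have hK₀ge : Λ ^ 3 ≤ (K₀ : ℝ) := by rw [hK₀def]; exact Nat.le_ceil _
    have hT : 1 / ((K₀ : ℝ) + 1 / 2 - t) + 1 / ((K₀ : ℝ) + 1 / 2 + t) ≤ 2 / Λ ^ 3 := by
      have h1 := (abs_le.1 ht4).1
      have h2 := (abs_le.1 ht4).2
      have hL3 : 0 < Λ ^ 3 := by positivity
      have e1 : 1 / ((K₀ : ℝ) + 1 / 2 - t) ≤ 1 / Λ ^ 3 := one_div_le_one_div_of_le hL3 (by linarith)
      have e2 : 1 / ((K₀ : ℝ) + 1 / 2 + t) ≤ 1 / Λ ^ 3 := one_div_le_one_div_of_le hL3 (by linarith)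
      have e3 : (2 : ℝ) / Λ ^ 3 = 1 / Λ ^ 3 + 1 / Λ ^ 3 := by ring
      linarith only [e1, e2, e3]
    have hlogN : Real.log ((N + 1 : ℕ) : ℝ) ≤ Λ + 1 := by
      have h1 : ((N + 1 : ℕ) : ℝ) ≤ 2 * x := by rw [hxdef]; push_cast; linarith
      calc Real.log ((N + 1 : ℕ) : ℝ) ≤ Real.log (2 * x) := Real.log_le_log (by positivity) h1
        _ = Real.log 2 + Λ := by rw [Real.log_mul (by norm_num) hx0.ne', hΛdef]
        _ ≤ Λ + 1 := by linarith [Real.log_two_lt_d9]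
    have hρρ : (1 + 1 / Λ) / ((1 + 1 / Λ) - 1) = Λ + 1 := by field_simp; ring
    rw [hρρ] at hA1
    have hL₁0 : 0 ≤ L₁ := by rw [hL₁def]; exact add_nonneg hA₃ (mul_nonneg hA₄ (Real.log_nonneg (by norm_num)))
    have hL₀0 : 0 ≤ L₀ := by rw [hL₀def]; exact add_nonneg hA₃ (mul_nonneg hA₄ (Real.log_nonneg (by norm_num)))
    have hK₀0 : (0 : ℝ) ≤ K₀ := Nat.cast_nonneg _
    have hLs0 : 0 ≤ Ls := by
      rw [hLsdef]; exact add_nonneg hA₃ (mul_nonneg hA₄ (Real.log_nonneg (by linarith only [hK₀0])))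
    have hMs0 : 0 ≤ Ms := by rw [hMsdef]; exact (Real.exp_pos _).le
    have hlogK₀ : 0 ≤ Real.log (K₀ : ℝ) := Real.log_nonneg (by
      have h8 : (2:ℝ) ^ 3 ≤ Λ ^ 3 := pow_le_pow_left₀ (by norm_num) hΛ2 3
      linarith only [h8, hK₀ge])
    have ht1 := (abs_le.1 ht4).1
    have ht2 := (abs_le.1 ht4).2
    have hT0 : 0 ≤ 1 / ((K₀ : ℝ) + 1 / 2 - t) + 1 / ((K₀ : ℝ) + 1 / 2 + t) :=
      add_nonneg (one_div_nonneg.2 (by linarith only [ht2, hK₀0])) (one_div_nonneg.2 (by linarith only [ht1, hK₀0]))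
    have hlogN1 : 0 ≤ Real.log ((N + 1 : ℕ) : ℝ) := Real.log_nonneg (by norm_cast; omega)
    -- abbreviations
    obtain ⟨B₀s, hB₀s⟩ : ∃ B : ℝ, B = 4 * M₀ * (2 / Λ) ^ β₀ / (Λ * (|α| / 2)) +
      8 * M₀ / Λ * (Λ ^ (montgomeryCoeff m 0) / (|α| / 2) + 2 + (|α| / 2) ^ (β₀ - 1) * (3 + 3 / (1 - β₀)) + L₀ / β₀) :=
      ⟨_, rfl⟩
    obtain ⟨B₀m, hB₀m⟩ : ∃ B : ℝ, B = 4 * M₀ * (2 / Λ) ^ β₀ / (Λ * amin) +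
      8 * M₀ / Λ * (Λ ^ (montgomeryCoeff m 0) / amin + 2 + amin ^ (β₀ - 1) * (3 + 3 / (1 - β₀)) + L₀ / β₀) :=
      ⟨_, rfl⟩
    obtain ⟨RN, hRN⟩ : ∃ RN : ℝ, RN = Ms / Λ * (40 * Λ ^ (1 / 3 : ℝ) + 48 * Ls + 224) * (2 * (1 + Real.log K₀)) +
          4 * M₁ * Λ ^ (β - 1) * (2 * Λ ^ (-(β / 2))) +
          (16 * L₁ + 32) * M₁ * (Λ ^ (-(1 / 2 : ℝ))) ^ (2 - β) +
          16 * M₁ / (Λ * 1) * (2 * (Λ ^ (-(1 / 2 : ℝ))) ^ (-(max β 0)) + 3 * L₁ + 14) +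
          (1 / ((K₀ : ℝ) + 1 / 2 - t) + 1 / ((K₀ : ℝ) + 1 / 2 + t)) *
            (6 * (1 + Real.log ((N + 1 : ℕ) : ℝ)) + 2 * (Λ + 1)) := ⟨_, rfl⟩
    have hB₀le : B₀s ≤ B₀m := by rw [hB₀s, hB₀m]; exact hB₀
    have hB₀pos : 0 ≤ B₀m := by
      have : 0 ≤ Λ ^ (montgomeryCoeff m 0) := Real.rpow_nonneg hΛ0.le _
      have : 0 ≤ amin ^ (β₀ - 1) := Real.rpow_nonneg hamin0.le _
      have : 0 ≤ (2 / Λ) ^ β₀ := Real.rpow_nonneg (by positivity) _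
      have : 0 < 1 - β₀ := by linarith only [hβ₀1]
      rw [hB₀m]; positivity
    have hsum1 : 0 ≤ Ms / Λ * (40 * Λ ^ (1 / 3 : ℝ) + 48 * Ls + 224) * (2 * (1 + Real.log K₀)) := by positivity
    have hsum2 : 0 ≤ 4 * M₁ * Λ ^ (β - 1) * (2 * Λ ^ (-(β / 2))) := by positivity
    have hsum3 : 0 ≤ (16 * L₁ + 32) * M₁ * (Λ ^ (-(1 / 2 : ℝ))) ^ (2 - β) := by positivity
    have hsum4 : 0 ≤ 16 * M₁ / (Λ * 1) * (2 * (Λ ^ (-(1 / 2 : ℝ))) ^ (-(max β 0)) + 3 * L₁ + 14) := by positivity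
    have hW0 : 0 ≤ 6 * (1 + Real.log ((N + 1 : ℕ) : ℝ)) + 2 * (Λ + 1) := by positivity
    have hRNpos : 0 ≤ RN := by
      rw [hRN]
      have := mul_nonneg hT0 hW0
      linarith only [hsum1, hsum2, hsum3, hsum4, this]
    have hRESTle : RN ≤ REST := by
      rw [hRN, hRESTdef]
      have h1 : (1 / ((K₀ : ℝ) + 1 / 2 - t) + 1 / ((K₀ : ℝ) + 1 / 2 + t)) *
          (6 * (1 + Real.log ((N + 1 : ℕ) : ℝ)) + 2 * (Λ + 1)) ≤ 2 / Λ ^ 3 * (6 * (1 + (Λ + 1)) + 2 * (Λ + 1)) :=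
        mul_le_mul hT (by linarith only [hlogN]) hW0 (by positivity)
      linarith only [h1]
    have hRESTpos : 0 ≤ REST := hRNpos.trans hRESTle
    have hA1' : ‖twistedPartialSum (fun n ↦ (montgomeryTwist m n : ℂ)) N s - montgomeryF m s -
        (x : ℂ) ^ (α : ℂ) * ((x : ℂ) ^ (((1 - t : ℝ) : ℂ) * I) * (D / ((α : ℂ) + ((1 - t : ℝ) : ℂ) * I)) *
          ((Λ ^ (β - 1) * Real.exp (-1) / Real.Gamma β : ℝ) : ℂ))‖ ≤ x ^ α * (1 / (2 * Real.pi) * (B₀s + RN)) := by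
      refine hA1.trans (le_of_eq ?_)
      rw [hB₀s, hRN]; ring
    have hE1 : ‖twistedPartialSum (fun n ↦ (montgomeryTwist m n : ℂ)) N s - montgomeryF m s -
        (x : ℂ) ^ (α : ℂ) * ((x : ℂ) ^ (((1 - t : ℝ) : ℂ) * I) * (D / ((α : ℂ) + ((1 - t : ℝ) : ℂ) * I)) *
          ((Λ ^ (β - 1) * Real.exp (-1) / Real.Gamma β : ℝ) : ℂ))‖ ≤ ‖C‖ / 40 + ‖C‖ / 40 := by
      refine hA1'.trans ?_
      have hxpos : 0 ≤ x ^ α := (Real.rpow_pos_of_pos hx0 α).le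
      have hπ0 : 0 < 1 / (2 * Real.pi) := by positivity
      have hB₀spos : 0 ≤ B₀s := by
        have hαpos : 0 < |α| / 2 := hamin0.trans_le has_lo
        have : 0 ≤ Λ ^ (montgomeryCoeff m 0) := Real.rpow_nonneg hΛ0.le _
        have : 0 ≤ (|α| / 2) ^ (β₀ - 1) := Real.rpow_nonneg hαpos.le _
        have : 0 ≤ (2 / Λ) ^ β₀ := Real.rpow_nonneg (by positivity) _
        have : 0 < 1 - β₀ := by linarith only [hβ₀1]
        rw [hB₀s]; positivity
      have e1 : x ^ α * (1 / (2 * Real.pi) * B₀s) ≤ 1 * (1 / (2 * Real.pi) * B₀m) :=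
        mul_le_mul hxα1 (mul_le_mul_of_nonneg_left hB₀le hπ0.le) (mul_nonneg hπ0.le hB₀spos) zero_le_one
      have e2 : x ^ α * (1 / (2 * Real.pi) * RN) ≤
          (2 * Real.exp (3 / 2) * Real.Gamma β * M₁ * ‖C‖ * Λ ^ (1 - β)) * (1 / (2 * Real.pi) * REST) :=
        mul_le_mul hxα2 (mul_le_mul_of_nonneg_left hRESTle hπ0.le) (mul_nonneg hπ0.le hRNpos) (by positivity)
      have e3 : x ^ α * (1 / (2 * Real.pi) * (B₀s + RN)) =
          x ^ α * (1 / (2 * Real.pi) * B₀s) + x ^ α * (1 / (2 * Real.pi) * RN) := by ring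
      have e4 : 1 * (1 / (2 * Real.pi) * B₀m) ≤ ‖C‖ / 40 := by
        have h1 : 1 * (1 / (2 * Real.pi) * B₀m) ≤ Real.exp 1 / (2 * Real.pi) * B₀m := by
          calc 1 * (1 / (2 * Real.pi) * B₀m) ≤ Real.exp 1 * (1 / (2 * Real.pi) * B₀m) :=
                mul_le_mul_of_nonneg_right (by linarith only [Real.add_one_le_exp (1:ℝ)]) (mul_nonneg hπ0.le hB₀pos)
            _ = _ := by ring
        rw [hB₀m] at h1 ⊢
        refine h1.trans (hC1.trans ?_)
        rw [div_le_div_iff₀ (by positivity) (by norm_num)]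
        have := mul_le_mul_of_nonneg_left hClo (by norm_num : (0:ℝ) ≤ 40)
        rw [show (40 : ℝ) * (u ^ β₀ / M₀) = u ^ β₀ * 40 / M₀ by ring, div_le_iff₀ hM₀] at this
        linarith only [this]
      have e5 : (2 * Real.exp (3 / 2) * Real.Gamma β * M₁ * ‖C‖ * Λ ^ (1 - β)) * (1 / (2 * Real.pi) * REST) ≤ ‖C‖ / 40 := by
        calc (2 * Real.exp (3 / 2) * Real.Gamma β * M₁ * ‖C‖ * Λ ^ (1 - β)) * (1 / (2 * Real.pi) * REST)
            = ‖C‖ * (2 * Real.exp (3 / 2) * Real.Gamma β * M₁ * Λ ^ (1 - β) * (1 / (2 * Real.pi)) * REST) := by ring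
          _ ≤ ‖C‖ * (1 / 40) := mul_le_mul_of_nonneg_left hC2 (norm_nonneg _)
          _ = ‖C‖ / 40 := by ring
      linarith only [e1, e2, e3, e4, e5]
    -- (3) `f(s)` against `C`
    have hE2 : ‖montgomeryF m s - C‖ ≤ ‖C‖ / 40 := by
      have hΦ := norm_phi_sub_real_le m h19 (σ₀ := 1 + u) (η := u / 2) (by positivity) (by linarith) (by linarith)
        (s := s) (by rw [← hσ]; linarith) (by rw [← hσ]; linarith) (by rw [← ht]; linarith [ht4])
      rw [← hL₀def, ← hβ₀def] at hΦ
      have hΦ' : ‖montgomeryPhi m s - montgomeryPhi m s₀₀‖ ≤ 1 / 80 := by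
        rw [hs₀₀]
        refine hΦ.trans ((mul_le_mul_of_nonneg_left (by simpa [hs₀₀] using hd) (by positivity)).trans hC3)
      have hfs : montgomeryF m s = exp (montgomeryPhi m s) := montgomeryF_eq_exp_phi m (by rw [← hσ]; linarith)
      have hfC : C = exp (montgomeryPhi m s₀₀) := by
        rw [hC]; exact montgomeryF_eq_exp_phi m (by rw [hure]; linarith)
      have hkey : montgomeryF m s - C = C * (exp (montgomeryPhi m s - montgomeryPhi m s₀₀) - 1) := by
        rw [hfs, hfC, mul_sub, mul_one, ← exp_add, add_sub_cancel]
      rw [hkey, norm_mul]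
      have := norm_exp_sub_one_le (x := montgomeryPhi m s - montgomeryPhi m s₀₀) (hΦ'.trans (by norm_num))
      calc ‖C‖ * ‖exp (montgomeryPhi m s - montgomeryPhi m s₀₀) - 1‖ ≤ ‖C‖ * (2 * (1 / 80)) :=
            mul_le_mul_of_nonneg_left (this.trans (by linarith)) (norm_nonneg _)
        _ = ‖C‖ / 40 := by ring
    -- (4) the main term against the model
    have hE3 : ‖(x : ℂ) ^ (α : ℂ) * ((x : ℂ) ^ (((1 - t : ℝ) : ℂ) * I) * (D / ((α : ℂ) + ((1 - t : ℝ) : ℂ) * I)) *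
          ((Λ ^ (β - 1) * Real.exp (-1) / Real.Gamma β : ℝ) : ℂ)) - a * exp (-(Λ : ℂ) * (s - 1))‖ ≤ ‖C‖ / 40 := by
      have hst : s = (σ : ℂ) + t * I := by rw [hσ, ht]; exact (re_add_im s).symm.trans (by simp [mul_comm])
      have hd1 : (α : ℂ) + ((1 - t : ℝ) : ℂ) * I = z₁ - s := by
        rw [hz₁, hst, hαdef]; simp only [zline]; push_cast; ring
      have hd1_lo : 3 / 4 ≤ ‖z₁ - s‖ := by
        calc (3 : ℝ) / 4 ≤ |(z₁ - s).im| := by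
              rw [← hd1]; simp only [add_im, ofReal_im, mul_im, ofReal_re, I_im, I_re, mul_zero, mul_one,
                zero_add, add_zero]
              have := (abs_le.1 ht4).2; rw [abs_of_pos (by linarith)]; linarith
          _ ≤ _ := abs_im_le_norm _
      have hd10 : z₁ - s ≠ 0 := by intro h; rw [h, norm_zero] at hd1_lo; linarith
      have hLc : (Λ : ℂ) ≠ 0 := ofReal_ne_zero.2 hΛ0.ne'
      have hexpid : (x : ℂ) ^ (α : ℂ) * (x : ℂ) ^ (((1 - t : ℝ) : ℂ) * I) =
          exp 1 * ((x : ℂ) ^ I * exp (-(Λ : ℂ) * (s - 1))) := by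
        rw [ofReal_cpow_eq_exp hx0, ofReal_cpow_eq_exp hx0, ofReal_cpow_eq_exp hx0, ← hΛdef, ← exp_add, ← exp_add,
          ← exp_add]
        congr 1
        rw [hst, hαdef]; push_cast
        field_simp
        ring
      have hΓc : (Real.Gamma β : ℂ) ≠ 0 := ofReal_ne_zero.2 hΓ.ne'
      have he1 : (Real.exp 1 : ℂ) * (Real.exp (-1) : ℂ) = 1 := by
        rw [← ofReal_mul, ← Real.exp_add]; norm_num
      have hident : (x : ℂ) ^ (α : ℂ) * ((x : ℂ) ^ (((1 - t : ℝ) : ℂ) * I) * (D / ((α : ℂ) + ((1 - t : ℝ) : ℂ) * I)) *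
          ((Λ ^ (β - 1) * Real.exp (-1) / Real.Gamma β : ℝ) : ℂ)) - a * exp (-(Λ : ℂ) * (s - 1)) =
          (a * exp (-(Λ : ℂ) * (s - 1))) * ((s - s₀₀) / (z₁ - s)) := by
        rw [hd1]
        have : (x : ℂ) ^ (α : ℂ) * ((x : ℂ) ^ (((1 - t : ℝ) : ℂ) * I) * (D / (z₁ - s)) *
            ((Λ ^ (β - 1) * Real.exp (-1) / Real.Gamma β : ℝ) : ℂ)) =
            ((x : ℂ) ^ (α : ℂ) * (x : ℂ) ^ (((1 - t : ℝ) : ℂ) * I)) * (D / (z₁ - s)) *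
            ((Λ ^ (β - 1) * Real.exp (-1) / Real.Gamma β : ℝ) : ℂ) := by ring
        rw [this, hexpid, ha]
        push_cast
        rw [Complex.exp_neg 1]
        have hE0 : cexp 1 ≠ 0 := exp_ne_zero 1
        field_simp
        ring
      rw [hident, norm_mul, norm_div]
      calc ‖a * exp (-(Λ : ℂ) * (s - 1))‖ * (‖s - s₀₀‖ / ‖z₁ - s‖) ≤ (‖C‖ * Real.exp (1 / 2)) * (R / (3 / 4)) := by
            refine mul_le_mul (hae_norm s hs) ?_ (by positivity) (by positivity)
            exact div_le_div₀ hR0 hd (by norm_num) hd1_lo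
        _ = ‖C‖ * (Real.exp (1 / 2) * R / (3 / 4)) := by ring
        _ ≤ ‖C‖ * (1 / 40) := mul_le_mul_of_nonneg_left hC4 (norm_nonneg _)
        _ = ‖C‖ / 40 := by ring
    -- combine
    have htot : ‖twistedPartialSum (fun n ↦ (montgomeryTwist m n : ℂ)) N s - (a * exp (-(Λ : ℂ) * (s - 1)) + C)‖ ≤
        (‖C‖ / 40 + ‖C‖ / 40) + ‖C‖ / 40 + ‖C‖ / 40 := by
      have : twistedPartialSum (fun n ↦ (montgomeryTwist m n : ℂ)) N s - (a * exp (-(Λ : ℂ) * (s - 1)) + C) =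
          (twistedPartialSum (fun n ↦ (montgomeryTwist m n : ℂ)) N s - montgomeryF m s -
            (x : ℂ) ^ (α : ℂ) * ((x : ℂ) ^ (((1 - t : ℝ) : ℂ) * I) * (D / ((α : ℂ) + ((1 - t : ℝ) : ℂ) * I)) *
              ((Λ ^ (β - 1) * Real.exp (-1) / Real.Gamma β : ℝ) : ℂ))) +
          (montgomeryF m s - C) +
          ((x : ℂ) ^ (α : ℂ) * ((x : ℂ) ^ (((1 - t : ℝ) : ℂ) * I) * (D / ((α : ℂ) + ((1 - t : ℝ) : ℂ) * I)) *
              ((Λ ^ (β - 1) * Real.exp (-1) / Real.Gamma β : ℝ) : ℂ)) - a * exp (-(Λ : ℂ) * (s - 1))) := by ring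
      rw [this]
      exact (norm_add₃_le).trans (add_le_add (add_le_add hE1 hE2) hE3)
    have : (‖C‖ / 40 + ‖C‖ / 40) + ‖C‖ / 40 + ‖C‖ / 40 < ‖C‖ / 8 := by linarith
    exact htot.trans_lt this
  -- Rouché
  obtain ⟨s, hs, hFs⟩ := exists_zero_of_norm_sub_exp_add_const_lt hΛ0 hC0 hmodel hFdiff.diffContOnCl hclose
  refine ⟨s, hFs, ?_⟩
  rw [Metric.mem_ball, dist_eq_norm] at hs
  have h1 : |(s - s₀).re| < 1 / (2 * Λ) := (abs_re_le_norm _).trans_lt hs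
  rw [sub_re] at h1
  have h2 := (abs_lt.1 h1).1
  have h3 : 1 + (κ * Real.log Λ - β₀ * Real.log (κ * Real.log Λ) - Kc - 1 / 2) / Λ =
      1 + (κ * Real.log Λ - β₀ * Real.log (κ * Real.log Λ) - Kc) / Λ - 1 / (2 * Λ) := by
    field_simp; ring
  rw [h3]
  linarith

end Assembly

end Line

section FinalAsym
open Asymptotics

/-- `(log x)^r x^{-s} → 0` (`s > 0`). [folklore] -/
theorem tendsto_log_rpow_mul_rpow_neg (r : ℝ) {s : ℝ} (hs : 0 < s) :
    Tendsto (fun x : ℝ ↦ Real.log x ^ r * x ^ (-s)) atTop (𝓝 0) := by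
  refine ((isLittleO_log_rpow_rpow_atTop r hs).tendsto_div_nhds_zero).congr' ?_
  filter_upwards [eventually_gt_atTop (0 : ℝ)] with x hx
  rw [div_eq_mul_inv, Real.rpow_neg hx.le]

/-- `log(κ y)/y → 0` as `y → ∞` (`κ > 0`). [folklore] -/
theorem tendsto_log_const_mul_div {κ : ℝ} (hκ : 0 < κ) :
    Tendsto (fun y : ℝ ↦ Real.log (κ * y) / y) atTop (𝓝 0) := by
  have h1 : Tendsto (fun y : ℝ ↦ Real.log κ * y⁻¹) atTop (𝓝 0) := by
    simpa using tendsto_inv_atTop_zero.const_mul (Real.log κ)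
  have h2 : Tendsto (fun y : ℝ ↦ Real.log y / y) atTop (𝓝 0) := by
    simpa using Real.isLittleO_log_id_atTop.tendsto_div_nhds_zero
  refine (h1.add h2).congr' ?_ |>.trans (by simp)
  filter_upwards [eventually_gt_atTop (0 : ℝ)] with y hy
  rw [Real.log_mul hκ.ne' hy.ne']; field_simp

/-- `log(κ log x)/log x → 0` (`κ > 0`). [folklore] -/
theorem tendsto_log_const_mul_log_div_log {κ : ℝ} (hκ : 0 < κ) :
    Tendsto (fun x : ℝ ↦ Real.log (κ * Real.log x) / Real.log x) atTop (𝓝 0) :=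
  (tendsto_log_const_mul_div hκ).comp Real.tendsto_log_atTop

/-- `(κ log x)^{-p} → 0` (`κ, p > 0`). [folklore] -/
theorem tendsto_const_mul_log_rpow_neg {κ p : ℝ} (hκ : 0 < κ) (hp : 0 < p) :
    Tendsto (fun x : ℝ ↦ (κ * Real.log x) ^ (-p)) atTop (𝓝 0) :=
  (tendsto_rpow_neg_atTop hp).comp (Real.tendsto_log_atTop.const_mul_atTop hκ)

/-- `κ log x → ∞`. [folklore] -/
theorem tendsto_const_mul_log {κ : ℝ} (hκ : 0 < κ) :
    Tendsto (fun x : ℝ ↦ κ * Real.log x) atTop atTop :=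
  Real.tendsto_log_atTop.const_mul_atTop hκ

/-- `log(κ log x)/(κ log x) → 0`. [folklore] -/
theorem tendsto_log_div_const_mul_log {κ : ℝ} (hκ : 0 < κ) :
    Tendsto (fun x : ℝ ↦ Real.log (κ * Real.log x) / (κ * Real.log x)) atTop (𝓝 0) := by
  have h : Tendsto (fun y : ℝ ↦ Real.log y / y) atTop (𝓝 0) := by
    simpa using Real.isLittleO_log_id_atTop.tendsto_div_nhds_zero
  exact h.comp (tendsto_const_mul_log hκ)

/-- `1/(κ log x) → 0`. [folklore] -/
theorem tendsto_inv_const_mul_log {κ : ℝ} (hκ : 0 < κ) :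
    Tendsto (fun x : ℝ ↦ 1 / (κ * Real.log x)) atTop (𝓝 0) := by
  have h := (tendsto_const_mul_log hκ).inv_tendsto_atTop
  refine h.congr' (Eventually.of_forall fun x ↦ ?_)
  simp [one_div]

/-! ## The hypotheses of the quantitative core hold for large `Λ` -/

/-- Basic size conditions. [folklore] -/
theorem eventually_basic {κ L₁ : ℝ} (hκ : 0 < κ) (B : ℝ) :
    ∀ᶠ Λ : ℝ in atTop, 16 ≤ Λ ∧ κ * Real.log Λ / Λ ≤ 1 / 2 ∧ 3 * (κ * Real.log Λ / Λ) / 4 ≤ 1 / 2 ∧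
      B ≤ κ * Real.log Λ ∧ (Real.pi + 1 / 2) / Λ ≤ 1 / 4 ∧ L₁ * Λ ^ (-(1 / 2 : ℝ)) ≤ 1 ∧ 1 ≤ Real.log Λ := by
  have hu : Tendsto (fun Λ : ℝ ↦ κ * Real.log Λ / Λ) atTop (𝓝 0) := by
    have h := (tendsto_log_rpow_mul_rpow_neg 1 one_pos).const_mul κ
    rw [mul_zero] at h
    refine h.congr' ?_
    filter_upwards [eventually_gt_atTop (0 : ℝ)] with Λ hΛ
    rw [Real.rpow_one, Real.rpow_neg hΛ.le, Real.rpow_one]; ring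
  have h1 : ∀ᶠ Λ : ℝ in atTop, κ * Real.log Λ / Λ ≤ 1 / 2 := hu.eventually_le_const (by norm_num)
  have h2 : ∀ᶠ Λ : ℝ in atTop, 3 * (κ * Real.log Λ / Λ) / 4 ≤ 1 / 2 := by
    have := (hu.const_mul 3).div_const 4
    rw [mul_zero, zero_div] at this
    exact this.eventually_le_const (by norm_num)
  have h3 : ∀ᶠ Λ : ℝ in atTop, B ≤ κ * Real.log Λ := (tendsto_const_mul_log hκ).eventually_ge_atTop B
  have h4 : ∀ᶠ Λ : ℝ in atTop, (Real.pi + 1 / 2) / Λ ≤ 1 / 4 :=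
    (tendsto_const_nhds.div_atTop tendsto_id).eventually_le_const (by norm_num)
  have h5 : ∀ᶠ Λ : ℝ in atTop, L₁ * Λ ^ (-(1 / 2 : ℝ)) ≤ 1 := by
    have := (tendsto_rpow_neg_atTop (by norm_num : (0:ℝ) < 1 / 2)).const_mul L₁
    rw [mul_zero] at this
    exact this.eventually_le_const (by norm_num)
  have h6 : ∀ᶠ Λ : ℝ in atTop, 1 ≤ Real.log Λ := Real.tendsto_log_atTop.eventually_ge_atTop 1
  filter_upwards [eventually_ge_atTop (16 : ℝ), h1, h2, h3, h4, h5, h6] with Λ a b c d e f g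
  exact ⟨a, b, c, d, e, f, g⟩

/-- The conditions involving `R` (with `y = κ log Λ`, `K' = K_c + π + 1/2`). [folklore] -/
theorem eventually_R {κ β₀ L₀ K : ℝ} (hκ : 0 < κ) :
    ∀ᶠ Λ : ℝ in atTop,
      (β₀ * Real.log (κ * Real.log Λ) + K) / (κ * Real.log Λ) ≤ 1 / 2 ∧
      2 * β₀ * ((β₀ * Real.log (κ * Real.log Λ) + K) / (κ * Real.log Λ)) +
        L₀ * ((β₀ * (κ * Real.log Λ) + K) / Λ) ≤ 1 / 80 ∧
      Real.exp (1 / 2) * ((β₀ * (κ * Real.log Λ) + K) / Λ) / (3 / 4) ≤ 1 / 40 := by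
  -- `(β₀ log y + K)/y → 0`
  have hA : Tendsto (fun Λ : ℝ ↦ (β₀ * Real.log (κ * Real.log Λ) + K) / (κ * Real.log Λ)) atTop (𝓝 0) := by
    have h1 := (tendsto_log_div_const_mul_log hκ).const_mul β₀
    have h2 := (tendsto_inv_const_mul_log hκ).const_mul K
    rw [mul_zero] at h1 h2
    have := h1.add h2
    rw [add_zero] at this
    refine this.congr' (Eventually.of_forall fun Λ ↦ ?_)
    ring
  -- `(β₀ y + K)/Λ → 0`
  have hB : Tendsto (fun Λ : ℝ ↦ (β₀ * (κ * Real.log Λ) + K) / Λ) atTop (𝓝 0) := by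
    have h1 : Tendsto (fun Λ : ℝ ↦ κ * Real.log Λ / Λ) atTop (𝓝 0) := by
      have h := (tendsto_log_rpow_mul_rpow_neg 1 one_pos).const_mul κ
      rw [mul_zero] at h
      refine h.congr' ?_
      filter_upwards [eventually_gt_atTop (0 : ℝ)] with Λ hΛ
      rw [Real.rpow_one, Real.rpow_neg hΛ.le, Real.rpow_one]; ring
    have h2 : Tendsto (fun Λ : ℝ ↦ K / Λ) atTop (𝓝 0) := tendsto_const_nhds.div_atTop tendsto_id
    have := (h1.const_mul β₀).add h2
    rw [mul_zero, add_zero] at this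
    refine this.congr' (Eventually.of_forall fun Λ ↦ ?_)
    ring
  have c1 := hA.eventually_le_const (show (0 : ℝ) < 1 / 2 by norm_num)
  have c2 : ∀ᶠ Λ : ℝ in atTop, 2 * β₀ * ((β₀ * Real.log (κ * Real.log Λ) + K) / (κ * Real.log Λ)) +
      L₀ * ((β₀ * (κ * Real.log Λ) + K) / Λ) ≤ 1 / 80 := by
    have := (hA.const_mul (2 * β₀)).add (hB.const_mul L₀)
    rw [mul_zero, mul_zero, add_zero] at this
    exact this.eventually_le_const (by norm_num)
  have c3 : ∀ᶠ Λ : ℝ in atTop, Real.exp (1 / 2) * ((β₀ * (κ * Real.log Λ) + K) / Λ) / (3 / 4) ≤ 1 / 40 := by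
    have := (hB.const_mul (Real.exp (1 / 2))).div_const (3 / 4)
    rw [mul_zero, zero_div] at this
    exact this.eventually_le_const (by norm_num)
  filter_upwards [c1, c2, c3] with Λ a b c
  exact ⟨a, b, c⟩

/-- The condition from the piece `k = 0` (majorant form). [folklore] -/
theorem eventually_k0 {κ β₀ M₀ L₀ C₄ : ℝ} (hκ : 0 < κ) (hβ₀ : 0 < β₀) (hβ₁ : β₀ < 1) :
    ∀ᶠ Λ : ℝ in atTop, 40 * M₀ * (Real.exp 1 / (2 * Real.pi)) *
      (32 * M₀ * (2 : ℝ) ^ β₀ * (κ * Real.log Λ) ^ (-(1 + β₀)) + 64 * M₀ * (κ * Real.log Λ) ^ (-(1 + β₀)) +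
        16 * M₀ * Λ ^ (-(1 - β₀)) + 8 * (8 : ℝ) ^ (1 - β₀) * M₀ * C₄ * (κ * Real.log Λ) ^ (-(1 : ℝ)) +
        8 * M₀ * L₀ / β₀ * Λ ^ (-(1 - β₀))) ≤ 1 := by
  have h1 := tendsto_const_mul_log_rpow_neg hκ (by linarith : 0 < 1 + β₀)
  have h2 := tendsto_rpow_neg_atTop (by linarith : 0 < 1 - β₀)
  have h3 := tendsto_const_mul_log_rpow_neg hκ one_pos
  have := ((((h1.const_mul (32 * M₀ * (2 : ℝ) ^ β₀)).add (h1.const_mul (64 * M₀))).add (h2.const_mul (16 * M₀))).add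
    (h3.const_mul (8 * (8 : ℝ) ^ (1 - β₀) * M₀ * C₄))).add (h2.const_mul (8 * M₀ * L₀ / β₀))
  simp only [mul_zero, add_zero] at this
  have := this.const_mul (40 * M₀ * (Real.exp 1 / (2 * Real.pi)))
  rw [mul_zero] at this
  exact this.eventually_le_const one_pos

/-- The condition from the remaining error terms (majorant form, `ℓ = log Λ`). [folklore] -/
theorem eventually_rest {Γβ M₁ L₁ A₁ A₂ A₃ A₄ : ℝ} :
    ∀ᶠ Λ : ℝ in atTop, 2 * Real.exp (3 / 2) * Γβ * M₁ * (1 / (2 * Real.pi)) *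
      (Real.exp A₁ * (4 : ℝ) ^ A₂ * 10 *
          (40 * (Real.log Λ ^ (A₂ + 1) * Λ ^ (-(1 / 6 : ℝ))) +
            (48 * A₃ + 224) * (Real.log Λ ^ (A₂ + 1) * Λ ^ (-(1 / 2 : ℝ))) +
            192 * A₄ * (Real.log Λ ^ (A₂ + 2) * Λ ^ (-(1 / 2 : ℝ)))) +
        (8 * M₁ + (16 * L₁ + 32) * M₁ + 32 * M₁) * Λ ^ (-(1 / 4 : ℝ)) +
        16 * M₁ * (3 * L₁ + 14) * Λ ^ (-(1 / 2 : ℝ)) + 44 * Λ ^ (-(3 / 2 : ℝ))) ≤ 1 / 40 := by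
  have g1 := tendsto_log_rpow_mul_rpow_neg (A₂ + 1) (by norm_num : (0:ℝ) < 1 / 6)
  have g2 := tendsto_log_rpow_mul_rpow_neg (A₂ + 1) (by norm_num : (0:ℝ) < 1 / 2)
  have g3 := tendsto_log_rpow_mul_rpow_neg (A₂ + 2) (by norm_num : (0:ℝ) < 1 / 2)
  have g4 := tendsto_rpow_neg_atTop (by norm_num : (0:ℝ) < 1 / 4)
  have g5 := tendsto_rpow_neg_atTop (by norm_num : (0:ℝ) < 1 / 2)
  have g6 := tendsto_rpow_neg_atTop (by norm_num : (0:ℝ) < 3 / 2)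
  have hin := ((g1.const_mul 40).add (g2.const_mul (48 * A₃ + 224))).add (g3.const_mul (192 * A₄))
  simp only [mul_zero, add_zero] at hin
  have := (((hin.const_mul (Real.exp A₁ * (4 : ℝ) ^ A₂ * 10)).add
    (g4.const_mul (8 * M₁ + (16 * L₁ + 32) * M₁ + 32 * M₁))).add (g5.const_mul (16 * M₁ * (3 * L₁ + 14)))).add
    (g6.const_mul 44)
  simp only [mul_zero, add_zero] at this
  have := this.const_mul (2 * Real.exp (3 / 2) * Γβ * M₁ * (1 / (2 * Real.pi)))
  rw [mul_zero] at this
  exact this.eventually_le_const (by norm_num)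

/-- The exponent wins: `β₀ log(κ log Λ) + K ≤ (κ − c) log Λ` eventually (`κ > c`). [folklore] -/
theorem eventually_exponent {κ c β₀ K : ℝ} (hκ : 0 < κ) (hc : c < κ) :
    ∀ᶠ Λ : ℝ in atTop, β₀ * Real.log (κ * Real.log Λ) + K ≤ (κ - c) * Real.log Λ := by
  have h1 := (tendsto_log_const_mul_log_div_log hκ).const_mul β₀
  have h2 : Tendsto (fun Λ : ℝ ↦ K / Real.log Λ) atTop (𝓝 0) := tendsto_const_nhds.div_atTop Real.tendsto_log_atTop
  rw [mul_zero] at h1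
  have h := h1.add h2
  rw [add_zero] at h
  have hev := h.eventually_le_const (show (0 : ℝ) < κ - c by linarith)
  filter_upwards [hev, Real.tendsto_log_atTop.eventually_gt_atTop (0 : ℝ)] with Λ hΛ hℓ
  have : β₀ * (Real.log (κ * Real.log Λ) / Real.log Λ) + K / Real.log Λ =
      (β₀ * Real.log (κ * Real.log Λ) + K) / Real.log Λ := by ring
  rw [this, div_le_iff₀ hℓ] at hΛ
  exact hΛ

/-! ## Pointwise majorants (pure `rpow` algebra) -/

/-- The `k = 0` error at `a₈ = y/(8Λ)` times `u^{-β₀}` (`u = y/Λ`) is at most the majorant of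
`eventually_k0`. [folklore] -/
theorem k0_bound_le {Λ y β₀ M₀ L₀ : ℝ} (hΛ : 0 < Λ) (hy : 1 ≤ y) (hβ₀ : 0 < β₀) (hβ₁ : β₀ < 1)
    (hM₀ : 0 ≤ M₀) (hL₀ : 0 ≤ L₀) :
    (4 * M₀ * (2 / Λ) ^ β₀ / (Λ * (y / (8 * Λ))) +
      8 * M₀ / Λ * (Λ ^ (-β₀) / (y / (8 * Λ)) + 2 + (y / (8 * Λ)) ^ (β₀ - 1) * (3 + 3 / (1 - β₀)) + L₀ / β₀)) *
      (y / Λ) ^ (-β₀) ≤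
    32 * M₀ * (2 : ℝ) ^ β₀ * y ^ (-(1 + β₀)) + 64 * M₀ * y ^ (-(1 + β₀)) +
      16 * M₀ * Λ ^ (-(1 - β₀)) + 8 * (8 : ℝ) ^ (1 - β₀) * M₀ * (3 + 3 / (1 - β₀)) * y ^ (-(1 : ℝ)) +
      8 * M₀ * L₀ / β₀ * Λ ^ (-(1 - β₀)) := by
  have hy0 : 0 < y := by linarith
  -- basic `rpow` identities
  have eu : (y / Λ) ^ (-β₀) = y ^ (-β₀) * Λ ^ β₀ := by
    rw [Real.div_rpow hy0.le hΛ.le, Real.rpow_neg hΛ.le, div_inv_eq_mul]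
  have e2 : (2 / Λ) ^ β₀ = (2 : ℝ) ^ β₀ * Λ ^ (-β₀) := by
    rw [Real.div_rpow zero_le_two hΛ.le, Real.rpow_neg hΛ.le, div_eq_mul_inv]
  have eΛ : Λ ^ (-β₀) * Λ ^ β₀ = 1 := by
    rw [Real.rpow_neg hΛ.le, inv_mul_cancel₀ (Real.rpow_pos_of_pos hΛ _).ne']
  have ey1 : y ^ (-(1 + β₀)) = y⁻¹ * y ^ (-β₀) := by
    rw [show -(1 + β₀) = (-1) + (-β₀) by ring, Real.rpow_add hy0, Real.rpow_neg_one]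
  have ea : (y / (8 * Λ)) ^ (β₀ - 1) = y ^ (β₀ - 1) * ((8 : ℝ) ^ (1 - β₀) * Λ ^ (1 - β₀)) := by
    rw [Real.div_rpow hy0.le (by positivity), Real.mul_rpow (by norm_num) hΛ.le, div_eq_mul_inv, mul_inv,
      ← Real.rpow_neg (by norm_num), ← Real.rpow_neg hΛ.le, neg_sub]
  have eyy : y ^ (β₀ - 1) * y ^ (-β₀) = y ^ (-(1 : ℝ)) := by
    rw [← Real.rpow_add hy0]; congr 1; ring
  have eΛΛ : Λ ^ (1 - β₀) * Λ ^ β₀ = Λ := by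
    rw [← Real.rpow_add hΛ]; simp
  have eΛ1 : Λ⁻¹ * Λ ^ β₀ = Λ ^ (-(1 - β₀)) := by
    rw [show -(1 - β₀) = (-1) + β₀ by ring, Real.rpow_add hΛ, Real.rpow_neg_one]
  have hyβ : y ^ (-β₀) ≤ 1 := Real.rpow_le_one_of_one_le_of_nonpos hy (by linarith)
  have hyβ0 : 0 ≤ y ^ (-β₀) := Real.rpow_nonneg hy0.le _
  have hΛβ0 : 0 ≤ Λ ^ β₀ := Real.rpow_nonneg hΛ.le _
  have hC₄ : 0 ≤ 3 + 3 / (1 - β₀) := by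
    have h : 0 < 1 - β₀ := by linarith
    positivity
  -- expand the left side into the five terms
  have hexp : (4 * M₀ * (2 / Λ) ^ β₀ / (Λ * (y / (8 * Λ))) +
      8 * M₀ / Λ * (Λ ^ (-β₀) / (y / (8 * Λ)) + 2 + (y / (8 * Λ)) ^ (β₀ - 1) * (3 + 3 / (1 - β₀)) + L₀ / β₀)) *
      (y / Λ) ^ (-β₀) =
      32 * M₀ * (2 : ℝ) ^ β₀ * (y⁻¹ * y ^ (-β₀)) * (Λ ^ (-β₀) * Λ ^ β₀) +
      64 * M₀ * (y⁻¹ * y ^ (-β₀)) * (Λ ^ (-β₀) * Λ ^ β₀) +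
      16 * M₀ * (Λ⁻¹ * Λ ^ β₀) * y ^ (-β₀) +
      8 * (8 : ℝ) ^ (1 - β₀) * M₀ * (3 + 3 / (1 - β₀)) * (y ^ (β₀ - 1) * y ^ (-β₀)) * ((Λ ^ (1 - β₀) * Λ ^ β₀) / Λ) +
      8 * M₀ * L₀ / β₀ * (Λ⁻¹ * Λ ^ β₀) * y ^ (-β₀) := by
    rw [eu, e2, ea]
    field_simp
    ring
  rw [hexp, eΛ, ← ey1, eyy, eΛΛ, div_self hΛ.ne', eΛ1]
  have h3 : 16 * M₀ * Λ ^ (-(1 - β₀)) * y ^ (-β₀) ≤ 16 * M₀ * Λ ^ (-(1 - β₀)) := by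
    have : 0 ≤ 16 * M₀ * Λ ^ (-(1 - β₀)) := by positivity
    exact mul_le_of_le_one_right this hyβ
  have h5 : 8 * M₀ * L₀ / β₀ * Λ ^ (-(1 - β₀)) * y ^ (-β₀) ≤ 8 * M₀ * L₀ / β₀ * Λ ^ (-(1 - β₀)) := by
    have : 0 ≤ 8 * M₀ * L₀ / β₀ * Λ ^ (-(1 - β₀)) := by positivity
    exact mul_le_of_le_one_right this hyβ
  linarith

/-- `Λ^{1−β} · REST ≤` the majorant of `eventually_rest` (`K₀ = ⌈Λ³⌉`, `ℓ = log Λ ≥ 1`, `Λ ≥ 16`,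
`1/2 ≤ β < 1`). [folklore] -/
theorem rest_bound_le {Λ β M₁ L₁ A₁ A₂ A₃ A₄ : ℝ} (hΛ : 16 ≤ Λ) (hℓ : 1 ≤ Real.log Λ) (hβ : 1 / 2 ≤ β) (hβ1 : β < 1)
    (hM₁ : 0 ≤ M₁) (hL₁ : 0 ≤ L₁) (hA₂ : 0 ≤ A₂) (hA₃ : 0 ≤ A₃) (hA₄ : 0 ≤ A₄) :
    Λ ^ (1 - β) * (Real.exp (A₁ + A₂ * Real.log (Real.log ((⌈Λ ^ 3⌉₊ : ℝ) + 5))) / Λ *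
        (40 * Λ ^ (1 / 3 : ℝ) + 48 * (A₃ + A₄ * Real.log ((⌈Λ ^ 3⌉₊ : ℝ) + 5)) + 224) * (2 * (1 + Real.log (⌈Λ ^ 3⌉₊ : ℝ))) +
      4 * M₁ * Λ ^ (β - 1) * (2 * Λ ^ (-(β / 2))) +
      (16 * L₁ + 32) * M₁ * (Λ ^ (-(1 / 2 : ℝ))) ^ (2 - β) +
      16 * M₁ / (Λ * 1) * (2 * (Λ ^ (-(1 / 2 : ℝ))) ^ (-(max β 0)) + 3 * L₁ + 14) +
      2 / Λ ^ 3 * (6 * (1 + (Λ + 1)) + 2 * (Λ + 1))) ≤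
    Real.exp A₁ * (4 : ℝ) ^ A₂ * 10 *
        (40 * (Real.log Λ ^ (A₂ + 1) * Λ ^ (-(1 / 6 : ℝ))) +
          (48 * A₃ + 224) * (Real.log Λ ^ (A₂ + 1) * Λ ^ (-(1 / 2 : ℝ))) +
          192 * A₄ * (Real.log Λ ^ (A₂ + 2) * Λ ^ (-(1 / 2 : ℝ)))) +
      (8 * M₁ + (16 * L₁ + 32) * M₁ + 32 * M₁) * Λ ^ (-(1 / 4 : ℝ)) +
      16 * M₁ * (3 * L₁ + 14) * Λ ^ (-(1 / 2 : ℝ)) + 44 * Λ ^ (-(3 / 2 : ℝ)) := by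
  set K₀ : ℕ := ⌈Λ ^ 3⌉₊ with hK₀def
  have hΛ0 : 0 < Λ := by linarith
  have hΛ1 : 1 ≤ Λ := by linarith
  set ℓ := Real.log Λ with hℓdef
  have hℓ0 : 0 < ℓ := by linarith
  -- `K₀` against `Λ`
  have hK₀lo : Λ ^ 3 ≤ (K₀ : ℝ) := Nat.le_ceil _
  have hK₀hi : (K₀ : ℝ) ≤ Λ ^ 3 + 1 := (Nat.ceil_lt_add_one (by positivity)).le
  have h8 : (16 : ℝ) ^ 3 ≤ Λ ^ 3 := pow_le_pow_left₀ (by norm_num) hΛ 3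
  have hK₀5 : (K₀ : ℝ) + 5 ≤ Λ ^ 4 := by
    have e : Λ ^ 4 = Λ * Λ ^ 3 := by ring
    have h1 : 16 * Λ ^ 3 ≤ Λ * Λ ^ 3 := mul_le_mul_of_nonneg_right hΛ (by positivity)
    rw [e]; norm_num at h8; linarith
  have hK₀1 : (1 : ℝ) ≤ K₀ := le_trans (by norm_num at h8; linarith) hK₀lo
  have hlogK5 : Real.log ((K₀ : ℝ) + 5) ≤ 4 * ℓ := by
    calc Real.log ((K₀ : ℝ) + 5) ≤ Real.log (Λ ^ 4) := Real.log_le_log (by linarith) hK₀5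
      _ = 4 * ℓ := by rw [Real.log_pow]; push_cast; ring
  have hlogK : Real.log (K₀ : ℝ) ≤ 4 * ℓ :=
    (Real.log_le_log (by linarith) (by linarith)).trans hlogK5
  have hlogK0 : 0 ≤ Real.log (K₀ : ℝ) := Real.log_nonneg hK₀1
  have hlogK5pos : 0 < Real.log ((K₀ : ℝ) + 5) := Real.log_pos (by linarith)
  -- `Ms ≤ e^{A₁} 4^{A₂} ℓ^{A₂}`
  have hMs : Real.exp (A₁ + A₂ * Real.log (Real.log ((K₀ : ℝ) + 5))) ≤ Real.exp A₁ * (4 : ℝ) ^ A₂ * ℓ ^ A₂ := by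
    rw [Real.exp_add, mul_assoc, ← Real.mul_rpow (by norm_num) hℓ0.le]
    refine mul_le_mul_of_nonneg_left ?_ (Real.exp_pos _).le
    rw [Real.rpow_def_of_pos (by positivity)]
    have := mul_le_mul_of_nonneg_left (Real.log_le_log hlogK5pos hlogK5) hA₂
    exact Real.exp_le_exp.2 (by linarith)
  have hLs : A₃ + A₄ * Real.log ((K₀ : ℝ) + 5) ≤ A₃ + 4 * A₄ * ℓ := by nlinarith
  -- powers of `Λ`
  have pβ : Λ ^ (-β) ≤ Λ ^ (-(1 / 2 : ℝ)) := Real.rpow_le_rpow_of_exponent_le hΛ1 (by linarith)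
  have pβ2 : Λ ^ (-(β / 2)) ≤ Λ ^ (-(1 / 4 : ℝ)) := Real.rpow_le_rpow_of_exponent_le hΛ1 (by linarith)
  have p13 : Λ ^ (1 / 3 : ℝ) * Λ ^ (-(1 / 2 : ℝ)) = Λ ^ (-(1 / 6 : ℝ)) := by
    rw [← Real.rpow_add hΛ0]; norm_num
  have pℓ1 : ℓ ^ A₂ * ℓ = ℓ ^ (A₂ + 1) := by rw [Real.rpow_add hℓ0, Real.rpow_one]
  have pℓ2 : ℓ ^ A₂ * ℓ * ℓ = ℓ ^ (A₂ + 2) := by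
    rw [Real.rpow_add hℓ0, show (2:ℝ) = 1 + 1 by norm_num, Real.rpow_add hℓ0, Real.rpow_one]; ring
  have hmax : max β 0 = β := max_eq_left (by linarith)
  -- term (i)
  have hℓA : 0 ≤ ℓ ^ A₂ := Real.rpow_nonneg hℓ0.le _
  have t1 : Λ ^ (1 - β) * (Real.exp (A₁ + A₂ * Real.log (Real.log ((K₀ : ℝ) + 5))) / Λ *
      (40 * Λ ^ (1 / 3 : ℝ) + 48 * (A₃ + A₄ * Real.log ((K₀ : ℝ) + 5)) + 224) * (2 * (1 + Real.log K₀))) ≤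
      Real.exp A₁ * (4 : ℝ) ^ A₂ * 10 *
        (40 * (ℓ ^ (A₂ + 1) * Λ ^ (-(1 / 6 : ℝ))) + (48 * A₃ + 224) * (ℓ ^ (A₂ + 1) * Λ ^ (-(1 / 2 : ℝ))) +
          192 * A₄ * (ℓ ^ (A₂ + 2) * Λ ^ (-(1 / 2 : ℝ)))) := by
    have e1 : Λ ^ (1 - β) / Λ = Λ ^ (-β) := by
      rw [div_eq_mul_inv, ← Real.rpow_neg_one, ← Real.rpow_add hΛ0]; congr 1; ring
    have step1 : Λ ^ (1 - β) * (Real.exp (A₁ + A₂ * Real.log (Real.log ((K₀ : ℝ) + 5))) / Λ *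
        (40 * Λ ^ (1 / 3 : ℝ) + 48 * (A₃ + A₄ * Real.log ((K₀ : ℝ) + 5)) + 224) * (2 * (1 + Real.log K₀))) =
        Λ ^ (-β) * Real.exp (A₁ + A₂ * Real.log (Real.log ((K₀ : ℝ) + 5))) *
        (40 * Λ ^ (1 / 3 : ℝ) + 48 * (A₃ + A₄ * Real.log ((K₀ : ℝ) + 5)) + 224) * (2 * (1 + Real.log K₀)) := by
      rw [← e1]; ring
    rw [step1]
    have hP : 0 ≤ 40 * Λ ^ (1 / 3 : ℝ) + 48 * (A₃ + A₄ * Real.log ((K₀ : ℝ) + 5)) + 224 := by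
      have : 0 ≤ Real.log ((K₀ : ℝ) + 5) := hlogK5pos.le
      positivity
    have step2 : Λ ^ (-β) * Real.exp (A₁ + A₂ * Real.log (Real.log ((K₀ : ℝ) + 5))) *
        (40 * Λ ^ (1 / 3 : ℝ) + 48 * (A₃ + A₄ * Real.log ((K₀ : ℝ) + 5)) + 224) * (2 * (1 + Real.log K₀)) ≤
        Λ ^ (-(1 / 2 : ℝ)) * (Real.exp A₁ * (4 : ℝ) ^ A₂ * ℓ ^ A₂) *
        (40 * Λ ^ (1 / 3 : ℝ) + 48 * (A₃ + 4 * A₄ * ℓ) + 224) * (10 * ℓ) := by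
      have hMs0 : 0 ≤ Real.exp A₁ * (4 : ℝ) ^ A₂ * ℓ ^ A₂ := by positivity
      have f1 : Λ ^ (-β) * Real.exp (A₁ + A₂ * Real.log (Real.log ((K₀ : ℝ) + 5))) ≤
          Λ ^ (-(1 / 2 : ℝ)) * (Real.exp A₁ * (4 : ℝ) ^ A₂ * ℓ ^ A₂) :=
        mul_le_mul pβ hMs (Real.exp_pos _).le (Real.rpow_nonneg hΛ0.le _)
      have f2 := mul_le_mul f1 (by linarith [hLs] : 40 * Λ ^ (1 / 3 : ℝ) + 48 * (A₃ + A₄ * Real.log ((K₀ : ℝ) + 5)) + 224 ≤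
          40 * Λ ^ (1 / 3 : ℝ) + 48 * (A₃ + 4 * A₄ * ℓ) + 224) hP (mul_nonneg (Real.rpow_nonneg hΛ0.le _) hMs0)
      refine mul_le_mul f2 (by linarith) (by positivity) ?_
      refine mul_nonneg (mul_nonneg (Real.rpow_nonneg hΛ0.le _) hMs0) ?_
      have : 0 ≤ Λ ^ (1 / 3 : ℝ) := Real.rpow_nonneg hΛ0.le _
      nlinarith
    refine step2.trans (le_of_eq ?_)
    rw [← p13, ← pℓ1, ← pℓ2]; ring
  -- term (ii)
  have t2 : Λ ^ (1 - β) * (4 * M₁ * Λ ^ (β - 1) * (2 * Λ ^ (-(β / 2)))) ≤ 8 * M₁ * Λ ^ (-(1 / 4 : ℝ)) := by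
    have e : Λ ^ (1 - β) * Λ ^ (β - 1) = 1 := by rw [← Real.rpow_add hΛ0]; simp
    calc Λ ^ (1 - β) * (4 * M₁ * Λ ^ (β - 1) * (2 * Λ ^ (-(β / 2)))) = 8 * M₁ * (Λ ^ (1 - β) * Λ ^ (β - 1)) * Λ ^ (-(β / 2)) := by ring
      _ = 8 * M₁ * Λ ^ (-(β / 2)) := by rw [e, mul_one]
      _ ≤ _ := mul_le_mul_of_nonneg_left pβ2 (by positivity)
  -- term (iii)
  have t3 : Λ ^ (1 - β) * ((16 * L₁ + 32) * M₁ * (Λ ^ (-(1 / 2 : ℝ))) ^ (2 - β)) ≤ (16 * L₁ + 32) * M₁ * Λ ^ (-(1 / 4 : ℝ)) := by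
    have e : Λ ^ (1 - β) * (Λ ^ (-(1 / 2 : ℝ))) ^ (2 - β) = Λ ^ (-(β / 2)) := by
      rw [← Real.rpow_mul hΛ0.le, ← Real.rpow_add hΛ0]; congr 1; ring
    calc Λ ^ (1 - β) * ((16 * L₁ + 32) * M₁ * (Λ ^ (-(1 / 2 : ℝ))) ^ (2 - β)) =
        (16 * L₁ + 32) * M₁ * (Λ ^ (1 - β) * (Λ ^ (-(1 / 2 : ℝ))) ^ (2 - β)) := by ring
      _ = (16 * L₁ + 32) * M₁ * Λ ^ (-(β / 2)) := by rw [e]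
      _ ≤ _ := mul_le_mul_of_nonneg_left pβ2 (by positivity)
  -- term (iv)
  have t4 : Λ ^ (1 - β) * (16 * M₁ / (Λ * 1) * (2 * (Λ ^ (-(1 / 2 : ℝ))) ^ (-(max β 0)) + 3 * L₁ + 14)) ≤
      32 * M₁ * Λ ^ (-(1 / 4 : ℝ)) + 16 * M₁ * (3 * L₁ + 14) * Λ ^ (-(1 / 2 : ℝ)) := by
    rw [hmax, mul_one]
    have e1 : Λ ^ (1 - β) / Λ = Λ ^ (-β) := by
      rw [div_eq_mul_inv, ← Real.rpow_neg_one, ← Real.rpow_add hΛ0]; congr 1; ring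
    have e2 : Λ ^ (-β) * (Λ ^ (-(1 / 2 : ℝ))) ^ (-β) = Λ ^ (-(β / 2)) := by
      rw [← Real.rpow_mul hΛ0.le, ← Real.rpow_add hΛ0]; congr 1; ring
    calc Λ ^ (1 - β) * (16 * M₁ / Λ * (2 * (Λ ^ (-(1 / 2 : ℝ))) ^ (-β) + 3 * L₁ + 14))
        = 32 * M₁ * (Λ ^ (1 - β) / Λ * (Λ ^ (-(1 / 2 : ℝ))) ^ (-β)) + 16 * M₁ * (3 * L₁ + 14) * (Λ ^ (1 - β) / Λ) := by ring
      _ = 32 * M₁ * Λ ^ (-(β / 2)) + 16 * M₁ * (3 * L₁ + 14) * Λ ^ (-β) := by rw [e1, e2]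
      _ ≤ _ := add_le_add (mul_le_mul_of_nonneg_left pβ2 (by positivity)) (mul_le_mul_of_nonneg_left pβ (by positivity))
  -- term (v)
  have t5 : Λ ^ (1 - β) * (2 / Λ ^ 3 * (6 * (1 + (Λ + 1)) + 2 * (Λ + 1))) ≤ 44 * Λ ^ (-(3 / 2 : ℝ)) := by
    have p1 : Λ ^ (1 - β) ≤ Λ ^ (1 / 2 : ℝ) := Real.rpow_le_rpow_of_exponent_le hΛ1 (by linarith)
    have e : Λ ^ (1 / 2 : ℝ) * Λ / Λ ^ 3 = Λ ^ (-(3 / 2 : ℝ)) := by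
      rw [show (Λ ^ 3 : ℝ) = Λ ^ (3 : ℝ) by norm_cast, div_eq_mul_inv, ← Real.rpow_neg hΛ0.le,
        show Λ ^ (1 / 2 : ℝ) * Λ = Λ ^ (1 / 2 : ℝ) * Λ ^ (1 : ℝ) by rw [Real.rpow_one], ← Real.rpow_add hΛ0,
        ← Real.rpow_add hΛ0]; norm_num
    have hlin : 6 * (1 + (Λ + 1)) + 2 * (Λ + 1) ≤ 22 * Λ := by linarith
    calc Λ ^ (1 - β) * (2 / Λ ^ 3 * (6 * (1 + (Λ + 1)) + 2 * (Λ + 1))) ≤ Λ ^ (1 / 2 : ℝ) * (2 / Λ ^ 3 * (22 * Λ)) := by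
          gcongr
      _ = 44 * (Λ ^ (1 / 2 : ℝ) * Λ / Λ ^ 3) := by ring
      _ = 44 * Λ ^ (-(3 / 2 : ℝ)) := by rw [e]
  have hsum : Λ ^ (1 - β) * (Real.exp (A₁ + A₂ * Real.log (Real.log ((K₀ : ℝ) + 5))) / Λ *
        (40 * Λ ^ (1 / 3 : ℝ) + 48 * (A₃ + A₄ * Real.log ((K₀ : ℝ) + 5)) + 224) * (2 * (1 + Real.log K₀)) +
      4 * M₁ * Λ ^ (β - 1) * (2 * Λ ^ (-(β / 2))) +
      (16 * L₁ + 32) * M₁ * (Λ ^ (-(1 / 2 : ℝ))) ^ (2 - β) +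
      16 * M₁ / (Λ * 1) * (2 * (Λ ^ (-(1 / 2 : ℝ))) ^ (-(max β 0)) + 3 * L₁ + 14) +
      2 / Λ ^ 3 * (6 * (1 + (Λ + 1)) + 2 * (Λ + 1))) =
      Λ ^ (1 - β) * (Real.exp (A₁ + A₂ * Real.log (Real.log ((K₀ : ℝ) + 5))) / Λ *
        (40 * Λ ^ (1 / 3 : ℝ) + 48 * (A₃ + A₄ * Real.log ((K₀ : ℝ) + 5)) + 224) * (2 * (1 + Real.log K₀))) +
      Λ ^ (1 - β) * (4 * M₁ * Λ ^ (β - 1) * (2 * Λ ^ (-(β / 2)))) +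
      Λ ^ (1 - β) * ((16 * L₁ + 32) * M₁ * (Λ ^ (-(1 / 2 : ℝ))) ^ (2 - β)) +
      Λ ^ (1 - β) * (16 * M₁ / (Λ * 1) * (2 * (Λ ^ (-(1 / 2 : ℝ))) ^ (-(max β 0)) + 3 * L₁ + 14)) +
      Λ ^ (1 - β) * (2 / Λ ^ 3 * (6 * (1 + (Λ + 1)) + 2 * (Λ + 1))) := by ring
  rw [hsum]
  linarith [t1, t2, t3, t4, t5]


end FinalAsym

set_option maxHeartbeats 1600000 in
/-- **Montgomery 1983, Theorem (p. 497).** For every `0 < c < 4/π − 1` and all `N > N₀(c)`, the section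
`Σ_{n ≤ N} n^{-s}` of the zeta function has a zero in `σ > 1 + c (log log N)/log N`.

Proof (following the source): §2 Bohr equivalence reduces to the twisted sections
`Σ_{n ≤ N} a(n) n^{-s}` (`Montgomery1983_theorem_of_twisted_zeros`); §§3–4 produce a zero of the
twisted section near `1 + (κ log log N − β₀ log log log N)/log N`
(`exists_twistedPartialSum_zero`), and `κ = b̂(1) − b̂(0) − 1` can be taken in `(c, 4/π − 1)`
(`exists_lt_montgomeryCoeff_one_sub_zero`). [cite: Montgomery1983, Theorem p. 497 and §§2–4] -/
theorem Montgomery1983_theorem_holds : Montgomery1983_theorem := by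
  refine Montgomery1983_theorem_of_twisted_zeros fun c hc0 hc1 ↦ ?_
  obtain ⟨m, hκc'⟩ := exists_lt_montgomeryCoeff_one_sub_zero hc1
  obtain ⟨κ, hκdef⟩ : ∃ κ : ℝ, κ = montgomeryCoeff m 1 - montgomeryCoeff m 0 - 1 := ⟨_, rfl⟩
  have hκc : c < κ := by rw [hκdef]; exact hκc'
  have hκ0 : 0 < κ := hc0.trans hκc
  have hκ' : 0 < montgomeryCoeff m 1 - montgomeryCoeff m 0 - 1 := by rw [← hκdef]; exact hκ0
  obtain ⟨A₁, A₂, hA₁, hA₂, h18⟩ := exists_norm_phi_add_log_le m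
  obtain ⟨A₃, A₄, hA₃, hA₄, h19⟩ := exists_norm_phiDeriv_add_inv_le m
  obtain ⟨β, hβdef⟩ : ∃ β : ℝ, β = montgomeryCoeff m 1 := ⟨_, rfl⟩
  obtain ⟨β₀, hβ₀def⟩ : ∃ β₀ : ℝ, β₀ = -montgomeryCoeff m 0 := ⟨_, rfl⟩
  have hβlo : 1 / 2 ≤ β := by rw [hβdef]; exact (montgomeryCoeff_one_bounds m).1
  have hβ1 : β < 1 := by rw [hβdef]; exact (abs_lt.1 (abs_montgomeryCoeff_lt_one m 1)).2
  have hβ₀0 : 0 < β₀ := by rw [hβ₀def]; linarith [(montgomeryCoeff_zero_bounds m).2]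
  have hβ₀1 : β₀ < 1 := by rw [hβ₀def]; linarith [(montgomeryCoeff_zero_bounds m).1]
  obtain ⟨M₁, hM₁def⟩ : ∃ M : ℝ, M = Real.exp (A₁ + A₂ * Real.log (Real.log 6)) := ⟨_, rfl⟩
  obtain ⟨L₁, hL₁def⟩ : ∃ L : ℝ, L = A₃ + A₄ * Real.log 6 := ⟨_, rfl⟩
  obtain ⟨M₀, hM₀def⟩ : ∃ M : ℝ, M = Real.exp (A₁ + A₂ * Real.log (Real.log 5)) := ⟨_, rfl⟩
  obtain ⟨L₀, hL₀def⟩ : ∃ L : ℝ, L = A₃ + A₄ * Real.log 5 := ⟨_, rfl⟩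
  obtain ⟨Kc, hKcdef⟩ : ∃ K : ℝ, K = (A₁ + A₂ * Real.log (Real.log 5)) + (A₁ + A₂ * Real.log (Real.log 6)) +
      |Real.log (Real.Gamma β)| + Real.log 2 := ⟨_, rfl⟩
  have hM₀0 : 0 < M₀ := by rw [hM₀def]; exact Real.exp_pos _
  have hM₁0 : 0 < M₁ := by rw [hM₁def]; exact Real.exp_pos _
  have hL₀0 : 0 ≤ L₀ := by rw [hL₀def]; exact add_nonneg hA₃ (mul_nonneg hA₄ (Real.log_nonneg (by norm_num)))
  have hL₁0 : 0 ≤ L₁ := by rw [hL₁def]; exact add_nonneg hA₃ (mul_nonneg hA₄ (Real.log_nonneg (by norm_num)))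
  have hΓ : 0 < Real.Gamma β := Real.Gamma_pos_of_pos (by linarith)
  -- everything eventually in `Λ`
  have hev := (eventually_basic (L₁ := L₁) hκ0 (max 8 (4 * Real.pi + 4))).and
    ((eventually_R (β₀ := β₀) (L₀ := L₀) (K := Kc + Real.pi + 1 / 2) hκ0).and
    ((eventually_k0 (M₀ := M₀) (L₀ := L₀) (C₄ := 3 + 3 / (1 - β₀)) hκ0 hβ₀0 hβ₀1).and
    ((eventually_rest (Γβ := Real.Gamma β) (M₁ := M₁) (L₁ := L₁) (A₁ := A₁) (A₂ := A₂) (A₃ := A₃) (A₄ := A₄)).and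
    (eventually_exponent (β₀ := β₀) (K := Kc + 1 / 2 + c) hκ0 hκc))))
  have hΛN : Tendsto (fun N : ℕ ↦ Real.log ((N : ℝ) + 1 / 2)) atTop atTop :=
    Real.tendsto_log_atTop.comp (tendsto_atTop_add_const_right _ _ tendsto_natCast_atTop_atTop)
  obtain ⟨N₀, hN₀⟩ := eventually_atTop.1 ((hΛN.eventually hev).and (eventually_ge_atTop 2))
  refine ⟨N₀, fun N hN ↦ ?_⟩
  obtain ⟨hall, hN2⟩ := hN₀ N hN.le
  obtain ⟨Λ, hΛdef⟩ : ∃ L : ℝ, L = Real.log ((N : ℝ) + 1 / 2) := ⟨_, rfl⟩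
  simp only [← hΛdef] at hall
  obtain ⟨⟨hΛ16, hu2, hu34, hy8, hπ4, hLw, hℓ1⟩, ⟨hR1, hR2, hR3⟩, hk0, hrest, hexp⟩ := hall
  -- shorthand quantities
  have hΛ0 : 0 < Λ := by linarith
  have hΛ1 : 1 ≤ Λ := by linarith
  obtain ⟨Y, hYdef⟩ : ∃ Y : ℝ, Y = κ * Real.log Λ := ⟨_, rfl⟩
  rw [← hYdef] at hu2 hu34 hy8 hR1 hR2 hR3 hk0 hexp
  have hY8 : 8 ≤ Y := le_trans (le_max_left _ _) hy8
  have hYπ : 4 * Real.pi + 4 ≤ Y := le_trans (le_max_right _ _) hy8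
  have hY0 : 0 < Y := by linarith
  have hY1 : 1 ≤ Y := by linarith
  set U : ℝ := Y / Λ with hU
  have hU0 : 0 < U := by positivity
  have hUdef : U = κ * Real.log Λ / Λ := by rw [hU, hYdef]
  -- the radius bound `R` and the quantities of the core theorem
  obtain ⟨R, hRdef⟩ : ∃ R : ℝ, R = (β₀ * Real.log Y + Kc + Real.pi + 1 / 2) / Λ := ⟨_, rfl⟩
  have hRY : R = (β₀ * Real.log Y + (Kc + Real.pi + 1 / 2)) / Y * U := by
    rw [hRdef, hU, div_mul_div_comm, mul_comm Y Λ, mul_div_mul_right _ _ hY0.ne']; ring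
  have hK'0 : 0 ≤ β₀ * Real.log Y + (Kc + Real.pi + 1 / 2) := by
    have hlogY : 0 ≤ Real.log Y := Real.log_nonneg hY1
    have h5 : 0 ≤ Real.log (Real.log 5) := Real.log_nonneg (by
      rw [← Real.log_exp 1]; exact Real.log_le_log (Real.exp_pos 1) (by linarith only [Real.exp_one_lt_d9]))
    have h6 : 0 ≤ Real.log (Real.log 6) := Real.log_nonneg (by
      rw [← Real.log_exp 1]; exact Real.log_le_log (Real.exp_pos 1) (by linarith only [Real.exp_one_lt_d9]))
    have h2 : 0 ≤ Real.log 2 := Real.log_nonneg one_le_two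
    have hg := abs_nonneg (Real.log (Real.Gamma β))
    have hπ := Real.pi_pos.le
    have hKc : 0 ≤ Kc := by
      rw [hKcdef]
      have := mul_nonneg hA₂ h5
      have := mul_nonneg hA₂ h6
      linarith only [hA₁, this, ‹0 ≤ A₂ * Real.log (Real.log 5)›, hg, h2]
    have := mul_nonneg hβ₀0.le hlogY
    linarith only [this, hKc, hπ]
  have hRu : R ≤ U / 2 := by
    rw [hRY]
    calc (β₀ * Real.log Y + (Kc + Real.pi + 1 / 2)) / Y * U ≤ 1 / 2 * U := mul_le_mul_of_nonneg_right hR1 hU0.le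
      _ = U / 2 := by ring
  have hRle : R ≤ (β₀ * Y + (Kc + Real.pi + 1 / 2)) / Λ := by
    rw [hRdef]
    refine div_le_div_of_nonneg_right ?_ hΛ0.le
    have h1 : Real.log Y ≤ Y := (Real.log_le_sub_one_of_pos hY0).trans (by linarith only [hY0])
    have := mul_le_mul_of_nonneg_left h1 hβ₀0.le
    linarith only [this]
  have hR0 : 0 ≤ R := by rw [hRY]; positivity
  -- geometric conditions
  have eamin : (U / 2 - 1 / Λ) / 2 = (Y - 2) / (4 * Λ) := by
    rw [hU]; field_simp; ring
  have hπa : (Real.pi + 1 / 2) / Λ ≤ (U / 2 - 1 / Λ) / 2 := by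
    rw [eamin, div_le_div_iff₀ hΛ0 (by positivity)]
    have := mul_le_mul_of_nonneg_right (show (Real.pi + 1 / 2) * 4 ≤ Y - 2 by linarith only [hYπ]) hΛ0.le
    linarith only [this]
  have hΛa : 1 / Λ ≤ (U / 2 - 1 / Λ) / 2 := by
    rw [eamin, div_le_div_iff₀ hΛ0 (by positivity)]
    have := mul_le_mul_of_nonneg_right (show (1 : ℝ) * 4 ≤ Y - 2 by linarith only [hY8]) hΛ0.le
    linarith only [this]
  -- `hC3`, `hC4`
  have hC3 : (β₀ / (U / 2) + L₀) * R ≤ 1 / 80 := by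
    refine le_trans ?_ hR2
    have e1 : β₀ / (U / 2) * R = 2 * β₀ * ((β₀ * Real.log Y + (Kc + Real.pi + 1 / 2)) / Y) := by
      rw [hRY]; field_simp
    have e2 : L₀ * R ≤ L₀ * ((β₀ * Y + (Kc + Real.pi + 1 / 2)) / Λ) := mul_le_mul_of_nonneg_left hRle hL₀0
    have e0 : (β₀ / (U / 2) + L₀) * R = β₀ / (U / 2) * R + L₀ * R := by ring
    linarith only [e0, e1, e2]
  have hC4 : Real.exp (1 / 2) * R / (3 / 4) ≤ 1 / 40 := by
    refine le_trans ?_ hR3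
    have := mul_le_mul_of_nonneg_left hRle (Real.exp_pos (1 / 2)).le
    exact div_le_div_of_nonneg_right this (by norm_num)
  -- `hC1` via the antitone bound at `a₈ = Y/(8Λ)`
  have ha₈ : Y / (8 * Λ) ≤ (U / 2 - 1 / Λ) / 2 := by
    rw [eamin, div_le_div_iff₀ (by positivity) (by positivity)]
    have := mul_le_mul_of_nonneg_right (show Y * 4 ≤ (Y - 2) * 8 by linarith only [hY8]) hΛ0.le
    linarith only [this]
  have ha₈0 : 0 < Y / (8 * Λ) := by positivity
  have hC1 : Real.exp 1 / (2 * Real.pi) * (4 * M₀ * (2 / Λ) ^ β₀ / (Λ * ((U / 2 - 1 / Λ) / 2)) +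
      8 * M₀ / Λ * (Λ ^ (montgomeryCoeff m 0) / ((U / 2 - 1 / Λ) / 2) + 2 +
        ((U / 2 - 1 / Λ) / 2) ^ (β₀ - 1) * (3 + 3 / (1 - β₀)) + L₀ / β₀)) ≤ U ^ β₀ / (40 * M₀) := by
    have hanti := pieceZeroBound_antitone (M₀ := M₀) (L₀ := L₀) (Λ := Λ) (β₀ := β₀) (b := montgomeryCoeff m 0)
      hM₀0.le hΛ0 hβ₀1 ha₈0 ha₈
    have hk := k0_bound_le (M₀ := M₀) (L₀ := L₀) hΛ0 hY1 hβ₀0 hβ₀1 hM₀0.le hL₀0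
    have hb0 : montgomeryCoeff m 0 = -β₀ := by rw [hβ₀def, neg_neg]
    rw [hb0] at hanti ⊢
    rw [← hU] at hk
    set B₈ := 4 * M₀ * (2 / Λ) ^ β₀ / (Λ * (Y / (8 * Λ))) +
      8 * M₀ / Λ * (Λ ^ (-β₀) / (Y / (8 * Λ)) + 2 + (Y / (8 * Λ)) ^ (β₀ - 1) * (3 + 3 / (1 - β₀)) + L₀ / β₀) with hB₈
    set BR := 32 * M₀ * (2 : ℝ) ^ β₀ * Y ^ (-(1 + β₀)) + 64 * M₀ * Y ^ (-(1 + β₀)) +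
      16 * M₀ * Λ ^ (-(1 - β₀)) + 8 * (8 : ℝ) ^ (1 - β₀) * M₀ * (3 + 3 / (1 - β₀)) * Y ^ (-(1 : ℝ)) +
      8 * M₀ * L₀ / β₀ * Λ ^ (-(1 - β₀)) with hBR
    have hUβ : 0 < U ^ β₀ := Real.rpow_pos_of_pos hU0 _
    have hB₈le : B₈ ≤ BR * U ^ β₀ := by
      have : B₈ = B₈ * U ^ (-β₀) * U ^ β₀ := by
        rw [mul_assoc, Real.rpow_neg hU0.le, inv_mul_cancel₀ hUβ.ne', mul_one]
      rw [this]
      exact mul_le_mul_of_nonneg_right hk hUβ.le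
    have hfinal : Real.exp 1 / (2 * Real.pi) * B₈ ≤ U ^ β₀ / (40 * M₀) := by
      have h1 : Real.exp 1 / (2 * Real.pi) * B₈ ≤ Real.exp 1 / (2 * Real.pi) * (BR * U ^ β₀) :=
        mul_le_mul_of_nonneg_left hB₈le (by positivity)
      refine h1.trans ?_
      rw [le_div_iff₀ (by positivity)]
      calc Real.exp 1 / (2 * Real.pi) * (BR * U ^ β₀) * (40 * M₀) =
          (40 * M₀ * (Real.exp 1 / (2 * Real.pi)) * BR) * U ^ β₀ := by ring
        _ ≤ 1 * U ^ β₀ := mul_le_mul_of_nonneg_right hk0 hUβ.le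
        _ = U ^ β₀ := one_mul _
    exact (mul_le_mul_of_nonneg_left hanti (by positivity)).trans hfinal
  -- `hC2` via the rest majorant
  have hC2 : 2 * Real.exp (3 / 2) * Real.Gamma β * M₁ * Λ ^ (1 - β) * (1 / (2 * Real.pi)) *
      (Real.exp (A₁ + A₂ * Real.log (Real.log ((⌈Λ ^ 3⌉₊ : ℝ) + 5))) / Λ *
          (40 * Λ ^ (1 / 3 : ℝ) + 48 * (A₃ + A₄ * Real.log ((⌈Λ ^ 3⌉₊ : ℝ) + 5)) + 224) *
          (2 * (1 + Real.log (⌈Λ ^ 3⌉₊ : ℝ))) +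
        4 * M₁ * Λ ^ (β - 1) * (2 * Λ ^ (-(β / 2))) +
        (16 * L₁ + 32) * M₁ * (Λ ^ (-(1 / 2 : ℝ))) ^ (2 - β) +
        16 * M₁ / (Λ * 1) * (2 * (Λ ^ (-(1 / 2 : ℝ))) ^ (-(max β 0)) + 3 * L₁ + 14) +
        2 / Λ ^ 3 * (6 * (1 + (Λ + 1)) + 2 * (Λ + 1))) ≤ 1 / 40 := by
    have hrb := rest_bound_le (M₁ := M₁) (L₁ := L₁) (A₁ := A₁) (A₂ := A₂) (A₃ := A₃) (A₄ := A₄)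
      hΛ16 hℓ1 hβlo hβ1 hM₁0.le hL₁0 hA₂ hA₃ hA₄
    refine le_trans ?_ hrest
    have e : ∀ P : ℝ, 2 * Real.exp (3 / 2) * Real.Gamma β * M₁ * Λ ^ (1 - β) * (1 / (2 * Real.pi)) * P =
        (2 * Real.exp (3 / 2) * Real.Gamma β * M₁ * (1 / (2 * Real.pi))) * (Λ ^ (1 - β) * P) := fun P ↦ by ring
    rw [e]
    exact mul_le_mul_of_nonneg_left hrb (by positivity)
  -- apply the core theorem
  have hN1 : 1 ≤ N := by omega
  obtain ⟨s, hs0, hsre⟩ := exists_twistedPartialSum_zero m h18 h19 hA₂ hA₃ hA₄ hκ' hN1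
    (x := (N : ℝ) + 1 / 2) rfl hΛdef hκdef hβdef hβ₀def hUdef hM₁def hL₁def hM₀def hL₀def hKcdef
    (by rw [hRdef, hYdef]) rfl rfl rfl rfl rfl
    (by linarith) hu2 (by rw [← hYdef]; exact hY1) hRu hπ4 hπa hΛa hu34 hLw hC3 hC4 hC1 hC2
  refine ⟨fun n ↦ (montgomeryTwist m n : ℂ), fun a b _ _ ↦ map_mul (montgomeryTwist m) a b,
    fun p hp ↦ norm_montgomeryTwist_prime m hp, s, hs0, ?_⟩
  -- the exponent
  have hsre' : 1 + (κ * Real.log Λ - β₀ * Real.log Y - Kc - 1 / 2) / Λ < s.re := by rw [hYdef]; exact hsre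
  have hkey : c * Real.log Λ + c ≤ κ * Real.log Λ - β₀ * Real.log Y - Kc - 1 / 2 := by linarith [hexp]
  have hN2' : (2 : ℝ) ≤ N := by exact_mod_cast hN2
  have hΛN0 : 0 < Real.log N := Real.log_pos (by linarith)
  have hΛNle : Real.log N ≤ Λ := by rw [hΛdef]; exact Real.log_le_log (by linarith) (by linarith)
  have hΛNge : Λ - 1 ≤ Real.log N := by
    rw [hΛdef]
    have h1 : Real.log ((N : ℝ) + 1 / 2) - Real.log N = Real.log (1 + 1 / (2 * N)) := by
      rw [← Real.log_div (by linarith) (by linarith)]; congr 1; field_simp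
    have h2 : Real.log (1 + 1 / (2 * N)) ≤ 1 / (2 * N) := by
      have := Real.log_le_sub_one_of_pos (show 0 < 1 + 1 / (2 * (N : ℝ)) by positivity); linarith
    have h3 : 1 / (2 * (N : ℝ)) ≤ 1 := by rw [div_le_one (by linarith)]; linarith
    linarith
  have hℓΛ : Real.log Λ ≤ Λ - 1 := Real.log_le_sub_one_of_pos hΛ0
  have hlogℓ : 0 ≤ Real.log Λ := by linarith
  calc 1 + c * Real.log (Real.log N) / Real.log N ≤ 1 + c * Real.log Λ / (Λ - 1) := by
        gcongr 1 + ?_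
        calc c * Real.log (Real.log N) / Real.log N ≤ c * Real.log Λ / Real.log N := by
              gcongr
          _ ≤ c * Real.log Λ / (Λ - 1) := div_le_div_of_nonneg_left (by positivity) (by linarith) hΛNge
    _ ≤ 1 + (c * Real.log Λ + c) / Λ := by
        gcongr 1 + ?_
        rw [div_le_div_iff₀ (by linarith only [hΛ16]) hΛ0]
        have := mul_le_mul_of_nonneg_left (show Real.log Λ + 1 ≤ Λ by linarith only [hℓΛ]) (mul_nonneg hc0.le hlogℓ)
        have h2 := mul_nonneg hc0.le (show (0:ℝ) ≤ Λ - 1 - Real.log Λ by linarith only [hℓΛ])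
        nlinarith only [this, h2, hlogℓ, hc0.le, hΛ0]
    _ ≤ 1 + (κ * Real.log Λ - β₀ * Real.log Y - Kc - 1 / 2) / Λ := by
        gcongr 1 + ?_
        exact div_le_div_of_nonneg_right hkey hΛ0.le
    _ < s.re := hsre'


end Literature.Barriers.RiemannHypothesis

end
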